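import Literature.Computability.Cryptography.WordRAMUniversal1
import Literature.Computability.Cryptography.WordRAMInline3
import HarnessLib

/-!
# The word RAM — a universal program, II: the machine and its specification

The universal program `Univ.U` of the refutation of the vendored transfer property
`FGReducible.trulySubTime` (`Literature.Computability.Cryptography.FGComplexity`), and its
complete specification `Univ.run_U`: on *every* input `q`, at word size `10 · inputWidth q`, it
halts within `Univ.uCost |q| W` steps (linear in `|q|` plus `O(log W)`) with output
`Univ.uAnswer q`, where

* if `q` is not well formed (`q₀ ≠ 0` or `q` shorter than its announced header
  `[0, n, k] ++ code` of `3 + 8 n` words): `[]`;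
* if `q` is well formed but not yet *big* (`|q|` below the threshold
  `(n + 1) · 2^e ^ 2^e`, `e = max k 1 · inputWidth hdr`, that makes `|q|` exceed the state bound
  of the stored program at the simulated word size `w₀ = k · inputWidth hdr`): the *grow* answer
  `q ++ 0^(2|q|)`;
* otherwise: `[1 + bit]`, where `bit = 1` iff the stored program `Program.decode n (q.drop 3)`,
  run at word size `w₀` on the header `hdr = q.take (3 + 8 n)` for `|q|` clamped steps
  (`WordRAM.runTotal`), has halted with output `[1]`.

The program is: the prologue `Inline.PRO 1` of `WordRAMInline1` (relocate `q` to cells `41 …`),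
the well-formedness test, the width routine `widthCode` of `WordRAMWidth` on the header, the
threshold test (a clamped product loop), then either the *grow* epilogue (`Inline.EPI` on a
tripled length) or the simulation: copy the header reduced modulo `2 ^ w₀` into the cells
`2Q …` (`Q = 2 ^ (W - 2)`), run `|q|` rounds of `Univ.STEP` (`WordRAMUniversal1`), and output
`[1 + bit]`.

## References

* S. A. Cook, R. A. Reckhow, *Time bounded random access machines*, J. Comput. Syst. Sci. 7
  (1973), 354–375, §2 (universal RAM programs).
-/

namespace Literature.Computability.Cryptography.WordRAM

open StateTransition

namespace Univ

/-! ## The answer function -/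

/-- Number of instructions announced by `q` (word `1`). [folklore] -/
def nPOf (q : List ℕ) : ℕ := q.getD 1 0

/-- Word-size constant announced by `q` (word `2`). [folklore] -/
def kOf (q : List ℕ) : ℕ := q.getD 2 0

/-- Length of the header `[0, n, k] ++ code` announced by `q`. [folklore] -/
def lhOf (q : List ℕ) : ℕ := 3 + 8 * nPOf q

/-- The header of `q`. [folklore] -/
def hdrOf (q : List ℕ) : List ℕ := q.take (lhOf q)

/-- `q` is well formed: word `0` is `0` and `q` is at least as long as its announced header. [folklore] -/
def WF (q : List ℕ) : Prop := q.getD 0 0 = 0 ∧ lhOf q ≤ q.length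

/-- `instance` — well-formedness is decidable. [folklore] -/
instance (q : List ℕ) : Decidable (WF q) := inferInstanceAs (Decidable (_ ∧ _))

/-- The exponent `e = max k 1 · inputWidth hdr`: `2 ^ e` bounds the values of the stored
program's run (`2 ^ w₀` and every header word). [folklore] -/
def eOf (q : List ℕ) : ℕ := max (kOf q) 1 * inputWidth (hdrOf q)

/-- `2 ^ e`. [folklore] -/
def tOf (q : List ℕ) : ℕ := 2 ^ eOf q

/-- `q` is big: `|q|` is at least `2 ^ e` and at least the state-count threshold
`(n + 1) · (2 ^ e) ^ (2 ^ e)`. [folklore] -/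
def Big (q : List ℕ) : Prop := tOf q ≤ q.length ∧ (nPOf q + 1) * tOf q ^ tOf q ≤ q.length

/-- `instance` — bigness is decidable. [folklore] -/
instance (q : List ℕ) : Decidable (Big q) := inferInstanceAs (Decidable (_ ∧ _))

/-- The stored program of `q`. [folklore] -/
def progOf (q : List ℕ) : Program := Program.decode (nPOf q) (q.drop 3)

/-- The simulated word size `w₀ = k · inputWidth hdr`. [folklore] -/
def w0Of (q : List ℕ) : ℕ := kOf q * inputWidth (hdrOf q)

/-- The configuration of the stored program after `|q|` clamped steps on the header. [folklore] -/
def cfgOf (q : List ℕ) : Cfg :=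
  runTotal (progOf q) (w0Of q) noOracle zeroCoins q.length (init (w0Of q) (hdrOf q))

/-- The answer bit: `1` iff the stored program has halted with output `[1]` within `|q|` steps. [folklore] -/
def bitOf (q : List ℕ) : ℕ :=
  if (cfgOf q).pc = none ∧ readOut (cfgOf q).mem = [1] then 1 else 0

/-- **The answer of the universal program** on `q`. [folklore] -/
def uAnswer (q : List ℕ) : List ℕ :=
  if WF q then (if Big q then [1 + bitOf q] else q ++ List.replicate (2 * q.length) 0) else []

/-! ## The program -/

/-- Position of the grow epilogue. [folklore] -/
def growPos : ℕ := 334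

/-- Well-formedness, part 1: `jz (dir 41) 91; cell 0 := 0; halt`. [folklore] -/
def G0 : List Instr := [.jz (.dir 41) 91, .op .add (.dir 0) (.imm 0) (.imm 0), .halt]

/-- Well-formedness, part 2: `3 := 8 · n + 3; 12 := [L < R3]`. [folklore] -/
def G1 : List OpSpec :=
  [(.mul, .dir 3, .dir 42, .imm 8), (.add, .dir 3, .dir 3, .imm 3), (.lt, .dir 12, .dir 40, .dir 3)]

/-- Set-up of the width routine on the header: `16 := R3`, `31 := 41`. [folklore] -/
def G2 : List OpSpec := [(.add, .dir 16, .dir 3, .imm 0), (.add, .dir 31, .imm 41, .imm 0)]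

/-- `12 := max k 1; 13 := e; 14 := 2 ^ e mod 2 ^ W`. [folklore] -/
def G3 : List OpSpec :=
  [(.eq, .dir 12, .dir 43, .imm 0), (.add, .dir 12, .dir 12, .dir 43), (.mul, .dir 13, .dir 12, .dir 26),
   (.shl, .dir 14, .imm 1, .dir 13)]

/-- `9 := P₀ = 2 ^ (k · inputWidth hdr); 12 := [L < 2 ^ e]`. [folklore] -/
def G4 : List OpSpec :=
  [(.mul, .dir 9, .dir 43, .dir 26), (.shl, .dir 9, .imm 1, .dir 9), (.lt, .dir 12, .dir 40, .dir 14)]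

/-- Threshold loop set-up: `17 := n + 1; 18 := L + 1; 19 := 2 ^ e`. [folklore] -/
def G5 : List OpSpec :=
  [(.add, .dir 17, .dir 42, .imm 1), (.add, .dir 18, .dir 40, .imm 1), (.add, .dir 19, .dir 14, .imm 0)]

/-- Threshold loop body: `17 := min (R17 · 2 ^ e) (L + 1)`, `19 -= 1`. [folklore] -/
def thrBody : List OpSpec :=
  [(.mul, .dir 17, .dir 17, .dir 14), (.lt, .dir 20, .dir 18, .dir 17), (.mul, .dir 21, .dir 20, .dir 18),
   (.sub, .dir 20, .imm 1, .dir 20), (.mul, .dir 17, .dir 17, .dir 20), (.add, .dir 17, .dir 17, .dir 21),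
   (.sub, .dir 19, .dir 19, .imm 1)]

/-- `12 := [L < R17]`. [folklore] -/
def G5b : List OpSpec := [(.lt, .dir 12, .dir 40, .dir 17)]

/-- Simulation set-up: `mem[2Q] := L_h mod P₀; 19 := L_h; 20 := 41; 21 := 2Q + 1`. [folklore] -/
def G6 : List OpSpec :=
  [(.mod, .ind 8, .dir 3, .dir 9), (.add, .dir 19, .dir 3, .imm 0), (.add, .dir 20, .imm 41, .imm 0),
   (.add, .dir 21, .dir 8, .imm 1)]

/-- Copy-in loop body: `mem[R21] := mem[R20] mod P₀; 20 += 1; 21 += 1; 19 -= 1`. [folklore] -/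
def cinBody : List OpSpec :=
  [(.mod, .ind 21, .ind 20, .dir 9), (.add, .dir 20, .dir 20, .imm 1), (.add, .dir 21, .dir 21, .imm 1),
   (.sub, .dir 19, .dir 19, .imm 1)]

/-- Registers of the simulation: `10 := L` (fuel), `11 := 0` (PC), `12 := 0` (H). [folklore] -/
def G7 : List OpSpec :=
  [(.add, .dir 10, .dir 40, .imm 0), (.add, .dir 11, .imm 0, .imm 0), (.add, .dir 12, .imm 0, .imm 0)]

/-- The final answer: `1 := 1 + H · [mem[2Q] = 1] · [mem[2Q+1] = 1]; 0 := 1`. [folklore] -/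
def G8 : List OpSpec :=
  [(.eq, .dir 13, .ind 8, .imm 1), (.add, .dir 14, .dir 8, .imm 1), (.eq, .dir 14, .ind 14, .imm 1),
   (.mul, .dir 13, .dir 13, .dir 14), (.mul, .dir 13, .dir 13, .dir 12), (.add, .dir 1, .dir 13, .imm 1),
   (.add, .dir 0, .imm 1, .imm 0)]

/-- **The universal program** (435 instructions): prologue `0–87`, well-formedness `88–95`,
header width `96–138`, threshold `139–163`, simulation set-up `164–176`, main loop `177–325`,
answer `326–333`, grow epilogue `334–434`. [folklore] -/
def U : Program :=
  Inline.PRO 1 ++ G0 ++ G1.map OpSpec.toInstr ++ [.jz (.dir 12) 96, .jmp 89] ++ G2.map OpSpec.toInstr ++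
    widthCode 98 0 ++ G3.map OpSpec.toInstr ++ [.jz (.dir 14) growPos] ++ G4.map OpSpec.toInstr ++
    [.jz (.dir 12) 149, .jmp growPos] ++ G5.map OpSpec.toInstr ++ loopBlock 152 19 thrBody ++
    G5b.map OpSpec.toInstr ++ [.jz (.dir 12) 164, .jmp growPos] ++ G6.map OpSpec.toInstr ++
    loopBlock 168 19 cinBody ++ G7.map OpSpec.toInstr ++ loopBlock 177 10 STEP ++
    G8.map OpSpec.toInstr ++ [.halt] ++ [.op .mul (.dir 40) (.dir 40) (.imm 3)] ++ Inline.EPI 335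

/-- Length of the round. [folklore] -/
theorem STEP_length : STEP.length = 147 := by
  simp [STEP, S1, S2, S2pre, fetches, fetch, opnd, opndA, opndB, S5, S6, S7, S8, blks, blk, pre, sel,
    pre1, pre2, pre3, pre4, pre5, pre6, pre7, pre8, pre9, pre10, pre11, pre12, S9, S10a, S10b, S11]

/-- Length of the universal program. [folklore] -/
theorem U_length : U.length = 435 := by
  simp [U, G0, G1, G2, G3, G4, G5, G5b, G6, G7, G8, thrBody, cinBody, STEP_length, growPos]

/-- Every instruction of the universal program is plain (neither `rand` nor `query`). [folklore] -/
theorem plain_of_mem_U {I : Instr} (h : I ∈ U) : Inline.Instr.Plain I := by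
  have hj : ∀ {x : Operand} {t : ℕ}, Inline.Instr.Plain (.jz x t) := ⟨rfl, rfl⟩
  have hm : ∀ {t : ℕ}, Inline.Instr.Plain (.jmp t) := ⟨rfl, rfl⟩
  have hh : Inline.Instr.Plain .halt := ⟨rfl, rfl⟩
  have ho : ∀ {o : BinOp} {d x y : Operand}, Inline.Instr.Plain (.op o d x y) := ⟨rfl, rfl⟩
  simp only [U, G0, List.mem_append, List.mem_cons, List.mem_nil_iff, or_false, or_assoc] at h
  rcases h with h | h | h | h | h | h | h | h | h | h | h | h | h | h | h | h | h | h | h | h | h | h |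
    h | h | h | h | h
  · exact Inline.plain_of_mem_PRO h
  · subst h; exact hj
  · subst h; exact ho
  · subst h; exact hh
  · exact Inline.plain_of_mem_map h
  · subst h; exact hj
  · subst h; exact hm
  · exact Inline.plain_of_mem_map h
  · exact Inline.plain_of_mem_widthCode h
  · exact Inline.plain_of_mem_map h
  · subst h; exact hj
  · exact Inline.plain_of_mem_map h
  · subst h; exact hj
  · subst h; exact hm
  · exact Inline.plain_of_mem_map h
  · exact Inline.plain_of_mem_loopBlock h
  · exact Inline.plain_of_mem_map h
  · subst h; exact hj
  · subst h; exact hm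
  · exact Inline.plain_of_mem_map h
  · exact Inline.plain_of_mem_loopBlock h
  · exact Inline.plain_of_mem_map h
  · exact Inline.plain_of_mem_loopBlock h
  · exact Inline.plain_of_mem_map h
  · subst h; exact hh
  · subst h; exact ho
  · exact Inline.plain_of_mem_EPI h

/-- The universal program is deterministic. [folklore] -/
theorem U_isDeterministic : U.IsDeterministic := fun _ h => (plain_of_mem_U h).1

/-- The universal program is oracle-free. [folklore] -/
theorem U_isOracleFree : U.IsOracleFree := fun _ h => (plain_of_mem_U h).2

/-! ## Semantics of the small blocks -/

/-- Semantics of G1: `R3 = 8 n + 3`, `R12 = [L < 8 n + 3]` (`n = cell 42`, `L = cell 40`). [folklore] -/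
theorem execOps_G1 {W : ℕ} (m : ℕ → ℕ) (hn : 8 * m 42 + 3 < 2 ^ W) :
    (execOps W m G1) 3 = 8 * m 42 + 3 ∧
    (execOps W m G1) 12 = (if m 40 < 8 * m 42 + 3 then 1 else 0) ∧
    ∀ a, a ∉ dests G1 → (execOps W m G1) a = m a := by
  refine ⟨?_, ?_, fun a ha => execOps_apply_of_not_mem_dests G1 m rfl ha⟩
  all_goals
    simp only [G1, execOps_cons, execOps_nil, execOp_dir, Operand.read_dir, Operand.read_imm, BinOp.eval]
    simp (config := { decide := true }) only [Function.update_self, Function.update_of_ne, ne_eq]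
    rw [Nat.mod_eq_of_lt (a := m 42 * 8) (by omega), Nat.mod_eq_of_lt (by omega)]
  · omega
  · simp [Nat.mul_comm]

/-- Semantics of G2: `R16 = R3`, `R31 = 41`. [folklore] -/
theorem execOps_G2 {W : ℕ} (m : ℕ → ℕ) (h3 : m 3 < 2 ^ W) (hW : 64 ≤ 2 ^ W) :
    (execOps W m G2) 16 = m 3 ∧ (execOps W m G2) 31 = 41 ∧
    ∀ a, a ∉ dests G2 → (execOps W m G2) a = m a := by
  refine ⟨?_, ?_, fun a ha => execOps_apply_of_not_mem_dests G2 m rfl ha⟩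
  all_goals
    simp only [G2, execOps_cons, execOps_nil, execOp_dir, Operand.read_dir, Operand.read_imm, BinOp.eval]
    simp (config := { decide := true }) only [Function.update_self, Function.update_of_ne, ne_eq]
  · rw [Nat.add_zero, Nat.mod_eq_of_lt h3]
  · exact Nat.mod_eq_of_lt (by omega)

/-- Semantics of G3: `R12 = max k 1`, `R13 = e = max k 1 · w_h`, `R14 = 2 ^ e mod 2 ^ W`
(`k = cell 43`, `w_h = R26`). [folklore] -/
theorem execOps_G3 {W : ℕ} (m : ℕ → ℕ) (hk : m 43 + 1 < 2 ^ W) (he : max (m 43) 1 * m 26 < 2 ^ W) :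
    (execOps W m G3) 13 = max (m 43) 1 * m 26 ∧
    (execOps W m G3) 14 = 2 ^ (max (m 43) 1 * m 26) % 2 ^ W ∧
    ∀ a, a ∉ dests G3 → (execOps W m G3) a = m a := by
  refine ⟨?_, ?_, fun a ha => execOps_apply_of_not_mem_dests G3 m rfl ha⟩
  all_goals
    simp only [G3, execOps_cons, execOps_nil, execOp_dir, Operand.read_dir, Operand.read_imm, BinOp.eval]
    simp (config := { decide := true }) only [Function.update_self, Function.update_of_ne, ne_eq]
    by_cases h0 : m 43 = 0
    · have e : max (m 43) 1 = 1 := by rw [h0]; rfl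
      rw [e, Nat.one_mul] at he
      simp only [h0, if_true, Nat.add_zero, Nat.mod_eq_of_lt (show 1 < 2 ^ W by omega), Nat.one_mul,
        Nat.mod_eq_of_lt he, Nat.max_eq_right (Nat.zero_le 1), Nat.shiftLeft_eq]
    · have e : max (m 43) 1 = m 43 := Nat.max_eq_left (by omega)
      rw [e] at he
      simp only [h0, if_false, Nat.zero_add, Nat.mod_eq_of_lt (show m 43 < 2 ^ W by omega),
        Nat.mod_eq_of_lt he, e, Nat.shiftLeft_eq, Nat.one_mul]

/-- Semantics of G4: `R9 = 2 ^ (k · w_h)`, `R12 = [L < R14]` (given `k · w_h < W`). [folklore] -/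
theorem execOps_G4 {W : ℕ} (m : ℕ → ℕ) (hkw : m 43 * m 26 < W) (hW : 1 ≤ W) :
    (execOps W m G4) 9 = 2 ^ (m 43 * m 26) ∧
    (execOps W m G4) 12 = (if m 40 < m 14 then 1 else 0) ∧
    ∀ a, a ∉ dests G4 → (execOps W m G4) a = m a := by
  have h1 : m 43 * m 26 < 2 ^ W := lt_trans hkw (Nat.lt_two_pow_self)
  have h2 : 2 ^ (m 43 * m 26) < 2 ^ W := Nat.pow_lt_pow_right (by norm_num) hkw
  have h3 : (1 : ℕ) < 2 ^ W := by
    have := Nat.one_lt_two_pow (n := W) (by omega); exact this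
  refine ⟨?_, ?_, fun a ha => execOps_apply_of_not_mem_dests G4 m rfl ha⟩
  · simp only [G4, execOps_cons, execOps_nil, execOp_dir, Operand.read_dir, Operand.read_imm, BinOp.eval]
    simp (config := { decide := true }) only [Function.update_self, Function.update_of_ne, ne_eq]
    rw [Nat.mod_eq_of_lt h1, Nat.shiftLeft_eq, Nat.one_mul, Nat.mod_eq_of_lt h2]
  · simp only [G4, execOps_cons, execOps_nil, execOp_dir, Operand.read_dir, Operand.read_imm, BinOp.eval]
    simp (config := { decide := true }) only [Function.update_self, Function.update_of_ne, ne_eq]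

/-- Semantics of G5: `R17 = n + 1`, `R18 = L + 1`, `R19 = R14`. [folklore] -/
theorem execOps_G5 {W : ℕ} (m : ℕ → ℕ) (hn : m 42 + 1 < 2 ^ W) (hL : m 40 + 1 < 2 ^ W) (ht : m 14 < 2 ^ W) :
    (execOps W m G5) 17 = m 42 + 1 ∧ (execOps W m G5) 18 = m 40 + 1 ∧ (execOps W m G5) 19 = m 14 ∧
    ∀ a, a ∉ dests G5 → (execOps W m G5) a = m a := by
  refine ⟨?_, ?_, ?_, fun a ha => execOps_apply_of_not_mem_dests G5 m rfl ha⟩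
  all_goals
    simp only [G5, execOps_cons, execOps_nil, execOp_dir, Operand.read_dir, Operand.read_imm, BinOp.eval]
    simp (config := { decide := true }) only [Function.update_self, Function.update_of_ne, ne_eq]
  · exact Nat.mod_eq_of_lt hn
  · exact Nat.mod_eq_of_lt hL
  · rw [Nat.add_zero, Nat.mod_eq_of_lt ht]

/-- Semantics of one round of the threshold loop: with `R14 = t ≥ 1`, `R18 = L + 1`,
`R17 = p ≤ L + 1`, `p · t < 2 ^ W`, counter `R19 ≥ 1`: `R17 := min (p · t) (L + 1)`,
`R19 -= 1`; only `17, 19, 20, 21` change. [folklore] -/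
theorem execOps_thrBody {W : ℕ} (m : ℕ → ℕ) (hpt : m 17 * m 14 < 2 ^ W) (hL : m 18 < 2 ^ W)
    (hc : 1 ≤ m 19) (hc' : m 19 < 2 ^ W) (h2 : 2 ≤ 2 ^ W) :
    (execOps W m thrBody) 17 = min (m 17 * m 14) (m 18) ∧
    (execOps W m thrBody) 19 = m 19 - 1 ∧
    (execOps W m thrBody) 14 = m 14 ∧ (execOps W m thrBody) 18 = m 18 ∧
    ∀ a, a ∉ dests thrBody → (execOps W m thrBody) a = m a := by
  refine ⟨?_, ?_, execOps_apply_of_not_mem_dests thrBody m rfl (by decide),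
    execOps_apply_of_not_mem_dests thrBody m rfl (by decide),
    fun a ha => execOps_apply_of_not_mem_dests thrBody m rfl ha⟩
  all_goals
    simp only [thrBody, execOps_cons, execOps_nil, execOp_dir, Operand.read_dir, Operand.read_imm,
      BinOp.eval]
    simp (config := { decide := true }) only [Function.update_self, Function.update_of_ne, ne_eq,
      Nat.mod_eq_of_lt hpt]
  · by_cases h : m 18 < m 17 * m 14
    · rw [if_pos h]
      simp [Nat.mod_eq_of_lt hL, Nat.mod_eq_of_lt (show 1 < 2 ^ W by omega), Nat.min_eq_right h.le]
    · rw [if_neg h]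
      simp [Nat.mod_eq_of_lt (show 1 < 2 ^ W by omega), Nat.mod_eq_of_lt hpt, Nat.min_eq_left (not_lt.1 h)]
  · exact sub_eval_of_le hc hc'

/-- The threshold loop: from `R17 = n + 1`, `R19 = t` (`t ≥ 1`), after `j ≤ t` rounds
`R17 = min ((n + 1) · t ^ j) (L + 1)` and `R19 = t - j`. [folklore] -/
theorem iterate_thrBody {W : ℕ} {m : ℕ → ℕ} {n L t : ℕ} (ht1 : 1 ≤ t) (h14 : m 14 = t)
    (h18 : m 18 = L + 1) (h17 : m 17 = n + 1) (h19 : m 19 = t) (hn : n + 1 ≤ L + 1)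
    (hov : (L + 1) * t < 2 ^ W) (hL : L + 1 < 2 ^ W) (htW : t < 2 ^ W) :
    ∀ j, j ≤ t →
      ((fun mem => execOps W mem thrBody)^[j] m) 17 = min ((n + 1) * t ^ j) (L + 1) ∧
      ((fun mem => execOps W mem thrBody)^[j] m) 19 = t - j ∧
      ((fun mem => execOps W mem thrBody)^[j] m) 14 = t ∧
      ((fun mem => execOps W mem thrBody)^[j] m) 18 = L + 1 ∧
      ∀ a, a ∉ dests thrBody → ((fun mem => execOps W mem thrBody)^[j] m) a = m a
  | 0, _ => ⟨by simp [h17, Nat.min_eq_left hn], by simp [h19], by simp [h14], by simp [h18],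
      fun a _ => rfl⟩
  | j + 1, hj => by
    obtain ⟨i17, i19, i14, i18, iff'⟩ := iterate_thrBody ht1 h14 h18 h17 h19 hn hov hL htW j (by omega)
    set mj := (fun mem => execOps W mem thrBody)^[j] m with hmj
    have h2 : 2 ≤ 2 ^ W := by omega
    have hp : mj 17 ≤ L + 1 := by rw [i17]; exact Nat.min_le_right _ _
    have hpt : mj 17 * mj 14 < 2 ^ W := by
      rw [i14]; exact lt_of_le_of_lt (Nat.mul_le_mul_right _ hp) hov
    obtain ⟨e17, e19, e14, e18, ef⟩ := execOps_thrBody mj hpt (by rw [i18]; exact hL)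
      (by rw [i19]; omega) (by rw [i19]; omega) h2
    rw [Function.iterate_succ_apply', ← hmj]
    refine ⟨?_, by rw [e19, i19]; omega, by rw [e14, i14], by rw [e18, i18], fun a ha => by rw [ef a ha, iff' a ha]⟩
    rw [e17, i17, i14, i18, pow_succ]
    -- min (min x (L+1) * t) (L+1) = min (x * t) (L+1)
    rcases le_or_gt ((n + 1) * t ^ j) (L + 1) with h | h
    · rw [Nat.min_eq_left h, Nat.mul_assoc]
    · rw [Nat.min_eq_right h.le]
      have h1 : L + 1 ≤ (L + 1) * t := Nat.le_mul_of_pos_right _ ht1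
      have h2' : L + 1 ≤ (n + 1) * (t ^ j * t) := by
        rw [← Nat.mul_assoc]; exact le_trans h.le (Nat.le_mul_of_pos_right _ ht1)
      rw [Nat.min_eq_right h1, Nat.min_eq_right h2']

/-- Semantics of G5b: `R12 = [L < R17]`. [folklore] -/
theorem execOps_G5b {W : ℕ} (m : ℕ → ℕ) :
    (execOps W m G5b) 12 = (if m 40 < m 17 then 1 else 0) ∧
    ∀ a, a ≠ 12 → (execOps W m G5b) a = m a := by
  simp only [G5b, execOps_cons, execOps_nil, execOp_dir, Operand.read_dir, BinOp.eval]
  exact ⟨by rw [Function.update_self]; split_ifs <;> rfl, fun a ha => by rw [Function.update_of_ne ha]⟩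

/-- Semantics of G6: `mem[2Q] := R3 mod P₀`, `R19 = R3`, `R20 = 41`, `R21 = 2Q + 1`
(`2Q = R8 ≥ 40`). [folklore] -/
theorem execOps_G6 {W : ℕ} (m : ℕ → ℕ) (h8 : 40 ≤ m 8) (h8W : m 8 + 1 < 2 ^ W) (h3 : m 3 < 2 ^ W)
    (hW : 64 ≤ 2 ^ W) :
    (execOps W m G6) (m 8) = m 3 % m 9 ∧ (execOps W m G6) 19 = m 3 ∧ (execOps W m G6) 20 = 41 ∧
    (execOps W m G6) 21 = m 8 + 1 ∧
    ∀ a, a ≠ m 8 → a ≠ 19 → a ≠ 20 → a ≠ 21 → (execOps W m G6) a = m a := by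
  have n19 : (19 : ℕ) ≠ m 8 := by omega
  have n20 : (20 : ℕ) ≠ m 8 := by omega
  have n21 : (21 : ℕ) ≠ m 8 := by omega
  have n3 : (3 : ℕ) ≠ m 8 := by omega
  have n8 : (8 : ℕ) ≠ m 8 := by omega
  simp only [G6, execOps_cons, execOps_nil, execOp_dir, execOp_ind, Operand.read_dir, Operand.read_imm,
    BinOp.eval]
  simp (config := { decide := true }) only [Function.update_self, Function.update_of_ne, ne_eq,
    n3, n8, not_false_eq_true, Nat.mod_eq_of_lt h8W]
  refine ⟨?_, by rw [Nat.add_zero, Nat.mod_eq_of_lt h3], Nat.mod_eq_of_lt (by omega), trivial,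
    fun a ha hb hc hd => ?_⟩
  · rw [Function.update_of_ne (Ne.symm n21), Function.update_of_ne (Ne.symm n20),
      Function.update_of_ne (Ne.symm n19), Function.update_self]
  · simp (config := { decide := true }) only [Function.update_of_ne, ne_eq, ha, hb, hc, hd,
      not_false_eq_true]

/-- Semantics of one round of the copy-in loop: `mem[R21] := mem[R20] mod P₀; R20 += 1; R21 += 1;
R19 -= 1` (pointers `≥ 40`, words). [folklore] -/
theorem execOps_cinBody {W : ℕ} (m : ℕ → ℕ) (h21 : 40 ≤ m 21) (h20W : m 20 + 1 < 2 ^ W)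
    (h21W : m 21 + 1 < 2 ^ W) (hc : 1 ≤ m 19) (hc' : m 19 < 2 ^ W) :
    execOps W m cinBody =
      Function.update (Function.update (Function.update
        (Function.update m (m 21) (m (m 20) % m 9)) 20 (m 20 + 1)) 21 (m 21 + 1)) 19 (m 19 - 1) := by
  have n20 : m 21 ≠ 20 := by omega
  have n21 : m 21 ≠ 21 := by omega
  have n19 : m 21 ≠ 19 := by omega
  simp only [cinBody, execOps_cons, execOps_nil, execOp_dir, execOp_ind, Operand.read_dir, Operand.read_ind,
    Operand.read_imm, BinOp.eval]
  simp (config := { decide := true }) only [Function.update_of_ne, ne_eq, Ne.symm n20, Ne.symm n21,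
    Ne.symm n19, not_false_eq_true, Nat.mod_eq_of_lt h20W, Nat.mod_eq_of_lt h21W, sub_eval_of_le hc hc']

/-- The memory after `j` rounds of the copy-in loop from source `41`, destination `d₀`, count `n`. [folklore] -/
def cinMem (m : ℕ → ℕ) (d₀ n j : ℕ) : ℕ → ℕ := fun a =>
  if a = 20 then 41 + j else if a = 21 then d₀ + j else if a = 19 then n - j
  else if d₀ ≤ a ∧ a < d₀ + j then m (41 + (a - d₀)) % m 9 else m a

/-- The copy-in loop: after `j ≤ n` rounds the memory is `cinMem m d₀ n j` (destination above the
source segment and above the registers). [folklore] -/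
theorem iterate_cinBody {W : ℕ} {m : ℕ → ℕ} {d₀ n : ℕ} (hd : 41 + n ≤ d₀) (hdW : d₀ + n < 2 ^ W)
    (h20 : m 20 = 41) (h21 : m 21 = d₀) (h19 : m 19 = n) :
    ∀ j, j ≤ n → (fun mm => execOps W mm cinBody)^[j] m = cinMem m d₀ n j
  | 0, _ => by
      funext a
      simp only [Function.iterate_zero, id_eq, cinMem, Nat.add_zero, Nat.sub_zero]
      split_ifs with h1 h2 h3 h4
      · rw [h1, h20]
      · rw [h2, h21]
      · rw [h3, h19]
      · omega
      · rfl
  | j + 1, hj => by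
      rw [Function.iterate_succ_apply', iterate_cinBody hd hdW h20 h21 h19 j (by omega)]
      have e20 : cinMem m d₀ n j 20 = 41 + j := by simp [cinMem]
      have e21 : cinMem m d₀ n j 21 = d₀ + j := by simp [cinMem]
      have e19 : cinMem m d₀ n j 19 = n - j := by simp [cinMem]
      have e9 : cinMem m d₀ n j 9 = m 9 := by simp [cinMem]; omega
      have esrc : cinMem m d₀ n j (41 + j) = m (41 + j) := by
        simp only [cinMem]
        rw [if_neg (by omega), if_neg (by omega), if_neg (by omega), if_neg (by omega)]
      rw [execOps_cinBody _ (by rw [e21]; omega) (by rw [e20]; omega)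
        (by rw [e21]; omega) (by rw [e19]; omega) (by rw [e19]; omega), e20, e21, e19, esrc, e9]
      funext a
      simp only [cinMem, Function.update_apply]
      by_cases a19 : a = 19
      · simp [a19]; omega
      simp only [a19, if_false]
      by_cases a21 : a = 21
      · simp [a21]; omega
      simp only [a21, if_false]
      by_cases a20 : a = 20
      · simp [a20]; omega
      simp only [a20, if_false]
      by_cases ha : a = d₀ + j
      · subst ha
        rw [if_pos rfl, if_pos (show d₀ ≤ d₀ + j ∧ d₀ + j < d₀ + (j + 1) from ⟨by omega, by omega⟩),
          Nat.add_sub_cancel_left]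
      · rw [if_neg ha]
        by_cases hr : d₀ ≤ a ∧ a < d₀ + (j + 1)
        · rw [if_pos hr, if_pos ⟨hr.1, by omega⟩]
        · rw [if_neg hr, if_neg (fun h => hr ⟨h.1, by omega⟩)]

/-- Semantics of G7: `R10 = L`, `R11 = 0`, `R12 = 0`. [folklore] -/
theorem execOps_G7 {W : ℕ} (m : ℕ → ℕ) (hL : m 40 < 2 ^ W) :
    (execOps W m G7) 10 = m 40 ∧ (execOps W m G7) 11 = 0 ∧ (execOps W m G7) 12 = 0 ∧
    ∀ a, a ∉ dests G7 → (execOps W m G7) a = m a := by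
  refine ⟨?_, ?_, ?_, fun a ha => execOps_apply_of_not_mem_dests G7 m rfl ha⟩
  all_goals
    simp only [G7, execOps_cons, execOps_nil, execOp_dir, Operand.read_dir, Operand.read_imm, BinOp.eval]
    simp (config := { decide := true }) only [Function.update_self, Function.update_of_ne, ne_eq]
  · rw [Nat.add_zero, Nat.mod_eq_of_lt hL]
  all_goals simp

/-- Semantics of G8: cell `1 := 1 + H · [mem (2Q) = 1] · [mem (2Q + 1) = 1]`, cell `0 := 1`
(`2Q = R8 ≥ 40`, `H = R12 ≤ 1`). [folklore] -/
theorem execOps_G8 {W : ℕ} (m : ℕ → ℕ) (h8 : 40 ≤ m 8) (h8W : m 8 + 1 < 2 ^ W) (h12 : m 12 ≤ 1)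
    (hW : 64 ≤ 2 ^ W) :
    (execOps W m G8) 0 = 1 ∧
    (execOps W m G8) 1 = 1 + m 12 * (if m (m 8) = 1 ∧ m (m 8 + 1) = 1 then 1 else 0) ∧
    ∀ a, a ∉ dests G8 → (execOps W m G8) a = m a := by
  have n13 : m 8 ≠ 13 := by omega
  have n14 : m 8 + 1 ≠ 14 := by omega
  have n13' : m 8 + 1 ≠ 13 := by omega
  refine ⟨?_, ?_, fun a ha => execOps_apply_of_not_mem_dests G8 m rfl ha⟩
  all_goals
    simp only [G8, execOps_cons, execOps_nil, execOp_dir, Operand.read_dir, Operand.read_ind,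
      Operand.read_imm, BinOp.eval]
    simp (config := { decide := true }) only [Function.update_self, Function.update_of_ne, ne_eq,
      Nat.mod_eq_of_lt h8W, n14, n13', not_false_eq_true]
  · exact Nat.mod_eq_of_lt (by omega)
  · rcases Nat.le_one_iff_eq_zero_or_eq_one.1 h12 with h | h <;>
      by_cases ha : m (m 8) = 1 <;> by_cases hb : m (m 8 + 1) = 1 <;>
      simp [h, ha, hb, Nat.mod_eq_of_lt (show 1 < 2 ^ W by omega), Nat.mod_eq_of_lt (show 2 < 2 ^ W by omega)]

/-! ## Placement of the blocks -/

/-- Placement of the blocks of the universal program. [folklore] -/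
theorem codeAt_U :
    CodeAt U 0 (Inline.PRO 1) ∧ U[88]? = some (.jz (.dir 41) 91) ∧
    U[89]? = some (.op .add (.dir 0) (.imm 0) (.imm 0)) ∧ U[90]? = some .halt ∧
    CodeAt U 91 (G1.map OpSpec.toInstr) ∧ U[94]? = some (.jz (.dir 12) 96) ∧ U[95]? = some (.jmp 89) ∧
    CodeAt U 96 (G2.map OpSpec.toInstr) ∧ CodeAt U 98 (widthCode 98 0) ∧
    CodeAt U 139 (G3.map OpSpec.toInstr) ∧ U[143]? = some (.jz (.dir 14) growPos) ∧
    CodeAt U 144 (G4.map OpSpec.toInstr) ∧ U[147]? = some (.jz (.dir 12) 149) ∧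
    U[148]? = some (.jmp growPos) ∧ CodeAt U 149 (G5.map OpSpec.toInstr) ∧
    CodeAt U 152 (loopBlock 152 19 thrBody) ∧ CodeAt U 161 (G5b.map OpSpec.toInstr) ∧
    U[162]? = some (.jz (.dir 12) 164) ∧ U[163]? = some (.jmp growPos) ∧
    CodeAt U 164 (G6.map OpSpec.toInstr) ∧ CodeAt U 168 (loopBlock 168 19 cinBody) ∧
    CodeAt U 174 (G7.map OpSpec.toInstr) ∧ CodeAt U 177 (loopBlock 177 10 STEP) ∧
    CodeAt U 326 (G8.map OpSpec.toInstr) ∧ U[333]? = some .halt ∧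
    U[334]? = some (.op .mul (.dir 40) (.dir 40) (.imm 3)) ∧ CodeAt U 335 (Inline.EPI 335) := by
  have h := codeAt_self U
  conv at h => arg 3; rw [U]
  obtain ⟨h, c21⟩ := codeAt_append_iff.1 h
  obtain ⟨h, c20⟩ := codeAt_append_iff.1 h
  obtain ⟨h, c19⟩ := codeAt_append_iff.1 h
  obtain ⟨h, c18⟩ := codeAt_append_iff.1 h
  obtain ⟨h, c17⟩ := codeAt_append_iff.1 h
  obtain ⟨h, c16⟩ := codeAt_append_iff.1 h
  obtain ⟨h, c15⟩ := codeAt_append_iff.1 h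
  obtain ⟨h, c14⟩ := codeAt_append_iff.1 h
  obtain ⟨h, c13⟩ := codeAt_append_iff.1 h
  obtain ⟨h, c12⟩ := codeAt_append_iff.1 h
  obtain ⟨h, c11⟩ := codeAt_append_iff.1 h
  obtain ⟨h, c10⟩ := codeAt_append_iff.1 h
  obtain ⟨h, c9⟩ := codeAt_append_iff.1 h
  obtain ⟨h, c8⟩ := codeAt_append_iff.1 h
  obtain ⟨h, c7⟩ := codeAt_append_iff.1 h
  obtain ⟨h, c6⟩ := codeAt_append_iff.1 h
  obtain ⟨h, c5⟩ := codeAt_append_iff.1 h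
  obtain ⟨h, c4⟩ := codeAt_append_iff.1 h
  obtain ⟨h, c3⟩ := codeAt_append_iff.1 h
  obtain ⟨h, c2⟩ := codeAt_append_iff.1 h
  obtain ⟨c0, c1⟩ := codeAt_append_iff.1 h
  simp only [List.length_append, List.length_map, List.length_cons, List.length_nil, loopBlock_length,
    Inline.PRO_length, widthCode_length, STEP_length, Nat.zero_add, show G1.length = 3 from rfl,
    show G2.length = 2 from rfl, show G3.length = 4 from rfl, show G4.length = 3 from rfl,
    show G5.length = 3 from rfl, show thrBody.length = 7 from rfl, show G5b.length = 1 from rfl,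
    show G6.length = 4 from rfl, show cinBody.length = 4 from rfl, show G7.length = 3 from rfl,
    show G8.length = 7 from rfl, show G0.length = 3 from rfl, Nat.reduceAdd]
    at c1 c2 c3 c4 c5 c6 c7 c8 c9 c10 c11 c12 c13 c14 c15 c16 c17 c18 c19 c20 c21
  have g0 := codeAt_cons_iff.1 c1
  have g1 := codeAt_cons_iff.1 g0.2
  have g2 := codeAt_cons_iff.1 g1.2
  have j3 := codeAt_cons_iff.1 c3
  have j3' := codeAt_cons_iff.1 j3.2
  have j9 := codeAt_cons_iff.1 c9
  have j9' := codeAt_cons_iff.1 j9.2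
  have j13 := codeAt_cons_iff.1 c13
  have j13' := codeAt_cons_iff.1 j13.2
  exact ⟨c0, g0.1, g1.1, g2.1, c2, j3.1, j3'.1, c4, c5, c6, (codeAt_cons_iff.1 c7).1, c8, j9.1, j9'.1,
    c10, c11, c12, j13.1, j13'.1, c14, c15, c16, c17, c18, (codeAt_cons_iff.1 c19).1,
    (codeAt_cons_iff.1 c20).1, c21⟩

/-! ## The stored program: bounds on its run -/

/-- The program counter of a run stays below any common bound of the program length and its jump
targets. [folklore] -/
theorem run_pc_le {P : Program} {w V : ℕ} {O : List ℕ → List ℕ} {ρ : ℕ → ℕ} {x : List ℕ}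
    (hlen : P.length ≤ V) (ht : ∀ I ∈ P, I.target ≤ V) :
    ∀ (n : ℕ) {c : Cfg}, run P w O ρ n (init w x) = some c → ∀ p, c.pc = some p → p ≤ V
  | 0, c, h, p, hp => by
      simp only [run_zero, Option.some.injEq] at h
      subst h
      simp at hp; omega
  | n + 1, c, h, p, hp => by
      rw [run_add] at h
      cases hd : run P w O ρ n (init w x) with
      | none => rw [hd] at h; simp at h
      | some d =>
        rw [hd, Option.bind_some, run_one] at h
        have ih := run_pc_le hlen ht n hd
        unfold step at h
        cases hdp : d.pc with
        | none => simp [hdp] at h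
        | some i =>
          simp only [hdp] at h
          cases hI : P[i]? with
          | none => simp only [hI, Option.some.injEq] at h; subst h; simp at hp
          | some I =>
            have hi : i < P.length := (List.getElem?_eq_some_iff.1 hI).1
            have hIt : I.target ≤ V := ht I (List.mem_of_getElem? hI)
            simp only [hI] at h
            cases I with
            | halt => simp only [Option.some.injEq] at h; subst h; simp at hp
            | op o d' y z =>
              simp only [Option.some.injEq] at h; subst h
              simp only [Option.some.injEq] at hp; omega
            | jmp t =>
              simp only [Option.some.injEq] at h; subst h
              simp only [Option.some.injEq] at hp; simp only [Instr.target] at hIt; omega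
            | jz y t =>
              simp only [Option.some.injEq] at h; subst h
              simp only [Instr.target] at hIt
              simp only at hp
              split_ifs at hp <;> simp only [Option.some.injEq] at hp <;> omega
            | rand d' =>
              simp only [Option.some.injEq] at h; subst h
              simp only [Option.some.injEq] at hp; omega
            | query qa ql aa =>
              simp only [Option.some.injEq] at h; subst h
              simp only [Option.some.injEq] at hp; omega

/-- The clamped run is always a live run at some earlier time. [folklore] -/
theorem exists_run_eq_runTotal (P : Program) (w : ℕ) (O : List ℕ → List ℕ) (ρ : ℕ → ℕ) (n : ℕ)
    (c : Cfg) : ∃ m, m ≤ n ∧ run P w O ρ m c = some (runTotal P w O ρ n c) := by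
  rcases run_or_halted P w O ρ n c with h | ⟨m, hm, h, -⟩
  · exact ⟨n, le_rfl, h⟩
  · exact ⟨m, hm, h⟩

/-! ## List bookkeeping -/

/-- The header is a prefix: its entries are entries of `q`. [folklore] -/
theorem getElem_hdrOf {q : List ℕ} {j : ℕ} (hj : j < lhOf q) (hL : lhOf q ≤ q.length) :
    q[j]'(by omega) ∈ hdrOf q := by
  have : (hdrOf q)[j]'(by simp [hdrOf]; omega) ∈ hdrOf q := List.getElem_mem _
  simpa [hdrOf, List.getElem_take] using this

/-- Entries of the header are below `2 ^ inputWidth hdr`. [folklore] -/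
theorem getElem_lt_of_lt_lhOf {q : List ℕ} {j : ℕ} (hj : j < lhOf q) (hL : lhOf q ≤ q.length) :
    q[j]'(by omega) < 2 ^ inputWidth (hdrOf q) :=
  lt_two_pow_inputWidth_of_mem _ _ (getElem_hdrOf hj hL)

/-- `readOut mem = [1]` iff cells `0` and `1` both hold `1`. [folklore] -/
theorem readOut_eq_singleton_one_iff (mem : ℕ → ℕ) : readOut mem = [1] ↔ mem 0 = 1 ∧ mem 1 = 1 := by
  constructor
  · intro h
    have hl : mem 0 = 1 := by simpa using congrArg List.length h
    refine ⟨hl, ?_⟩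
    rw [readOut, hl] at h
    simpa [readSeg] using h
  · rintro ⟨h0, h1⟩
    rw [readOut, h0]
    simp [readSeg, h1]

/-- A segment read off cells holding `q` followed by zeros is `q ++ 0^(len - |q|)`. [folklore] -/
theorem readSeg_eq_append_replicate {mem : ℕ → ℕ} {a len : ℕ} {q : List ℕ} (hlen : q.length ≤ len)
    (hq : ∀ j (hj : j < q.length), mem (a + j) = q[j]) (hz : ∀ j, q.length ≤ j → j < len → mem (a + j) = 0) :
    readSeg mem a len = q ++ List.replicate (len - q.length) 0 := by
  apply List.ext_getElem
  · simp; omega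
  · intro j h1 h2
    simp only [readSeg, List.getElem_map, List.getElem_range]
    by_cases hj : j < q.length
    · rw [List.getElem_append_left hj, hq j hj]
    · rw [List.getElem_append_right (by omega), List.getElem_replicate, hz j (by omega) (by simpa using h1)]

/-! ## Geometry of the word size `W = 10 · inputWidth q` -/

/-- With `X = 2 ^ inputWidth q` and `W = 10 · inputWidth q`: `Q = 2 ^ (W - 2) ≥ 64 X²`. [folklore] -/
theorem geom (q : List ℕ) :
    64 * (2 ^ inputWidth q * 2 ^ inputWidth q) ≤ Inline.Qv (10 * inputWidth q) := by
  have hw := inputWidth_pos q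
  unfold Inline.Qv
  rw [show (64 : ℕ) = 2 ^ 6 from rfl, ← pow_add, ← pow_add]
  exact Nat.pow_le_pow_right (by omega) (by omega)

/-! ## The stored program of a well-formed input -/

/-- Fields of the stored program are header words: `(q.drop 3).getD n 0 = q[3 + n]`. [folklore] -/
theorem drop3_getD {q : List ℕ} {n : ℕ} (h : 3 + n < q.length) : (q.drop 3).getD n 0 = q[3 + n] := by
  rw [List.getD_eq_getElem?_getD, List.getElem?_drop, List.getElem?_eq_getElem h, Option.getD_some]

/-- The stored program has the announced length. [folklore] -/
@[simp] theorem progOf_length (q : List ℕ) : (progOf q).length = nPOf q := Program.decode_length _ _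

/-- `2 ^ inputWidth hdr ≤ 2 ^ e`. [folklore] -/
theorem two_pow_wh_le_tOf (q : List ℕ) : 2 ^ inputWidth (hdrOf q) ≤ tOf q :=
  Nat.pow_le_pow_right (by norm_num) (Nat.le_mul_of_pos_left _ (lt_max_of_lt_right Nat.one_pos))

/-- `2 ^ w₀ ≤ 2 ^ e`. [folklore] -/
theorem two_pow_w0_le_tOf (q : List ℕ) : 2 ^ w0Of q ≤ tOf q :=
  Nat.pow_le_pow_right (by norm_num) (Nat.mul_le_mul_right _ (le_max_left _ _))

/-- `w₀ ≤ e`. [folklore] -/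
theorem w0Of_le_eOf (q : List ℕ) : w0Of q ≤ eOf q := Nat.mul_le_mul_right _ (le_max_left _ _)

/-- `2 ≤ 2 ^ e`. [folklore] -/
theorem two_le_tOf (q : List ℕ) : 2 ≤ tOf q := by
  have h : 1 ≤ eOf q := by
    have := Nat.mul_le_mul (le_max_right (kOf q) 1) (inputWidth_pos (hdrOf q))
    simpa [eOf] using this
  have := Nat.pow_le_pow_right (show 0 < 2 by norm_num) h
  simpa [tOf] using this

/-- Header words are below `2 ^ e`. [folklore] -/
theorem getElem_lt_tOf {q : List ℕ} (hWF : WF q) {j : ℕ} (hj : j < lhOf q) :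
    q[j]'(by have := hWF.2; omega) < tOf q :=
  lt_of_lt_of_le (getElem_lt_of_lt_lhOf hj hWF.2) (two_pow_wh_le_tOf q)

/-- The announced length `n` is a header word, hence `< 2 ^ e`. [folklore] -/
theorem nPOf_lt_tOf {q : List ℕ} (hWF : WF q) : nPOf q < tOf q := by
  have hL := hWF.2
  have h3 : 1 < q.length := by unfold lhOf at hL; omega
  have e : nPOf q = q[1] := by unfold nPOf; rw [List.getD_eq_getElem?_getD, List.getElem?_eq_getElem h3]; rfl
  rw [e]
  exact getElem_lt_tOf hWF (by unfold lhOf; omega)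

/-- The value bound of the stored program at the simulated word size is `< 2 ^ e`. [folklore] -/
theorem valueBound_progOf_le {q : List ℕ} (hWF : WF q) : valueBound (progOf q) (w0Of q) ≤ tOf q - 1 := by
  have ht := two_le_tOf q
  have hw := two_pow_w0_le_tOf q
  refine max_le (by omega) (max_le ?_ (by omega))
  refine Program.maxConst_decode_le fun j hj => ?_
  have hL := hWF.2
  have hj' : 3 + j < q.length := by unfold lhOf at hL; omega
  rw [drop3_getD hj']
  have := getElem_lt_tOf hWF (j := 3 + j) (by unfold lhOf; omega)
  omega

/-- Jump targets of the stored program are `< 2 ^ e`. [folklore] -/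
theorem target_le_of_mem_progOf {q : List ℕ} (hWF : WF q) {I : Instr} (hI : I ∈ progOf q) :
    I.target ≤ tOf q - 1 := by
  refine Program.target_le_of_mem_decode (fun j hj => ?_) hI
  have hL := hWF.2
  have hj' : 3 + j < q.length := by unfold lhOf at hL; omega
  rw [drop3_getD hj']
  have := getElem_lt_tOf hWF (j := 3 + j) (by unfold lhOf; omega)
  omega

/-- Every configuration of the clamped run of the stored program is `(2 ^ e - 1)`-bounded and has
program counter `≤ 2 ^ e - 1`. [folklore] -/
theorem cfg_bounds {q : List ℕ} (hWF : WF q) (r : ℕ) :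
    MemLE (tOf q - 1) (runTotal (progOf q) (w0Of q) noOracle zeroCoins r (init (w0Of q) (hdrOf q))).mem ∧
    ∀ p, (runTotal (progOf q) (w0Of q) noOracle zeroCoins r (init (w0Of q) (hdrOf q))).pc = some p →
      p ≤ tOf q - 1 := by
  obtain ⟨m, -, hm⟩ := exists_run_eq_runTotal (progOf q) (w0Of q) noOracle zeroCoins r (init (w0Of q) (hdrOf q))
  refine ⟨fun a => le_trans (memLE_of_iterate_init (n := m) hm a) (valueBound_progOf_le hWF), ?_⟩
  have hnP := nPOf_lt_tOf hWF
  exact run_pc_le (by rw [progOf_length]; omega) (fun I hI => target_le_of_mem_progOf hWF hI) m hm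

/-! ## Preserved memory facts -/

/-- The memory facts established by the prologue and preserved by the register phases: cell `40`
holds `|q|`, cells `41 …` hold `q`, then zeros up to `Q`, register `8` holds `2Q`, all cells are
words. [folklore] -/
structure Frame (W : ℕ) (q : List ℕ) (m : ℕ → ℕ) : Prop where
  /-- Cell `40` holds the input length. -/
  h40 : m 40 = q.length
  /-- Cells `41 …` hold the input. -/
  hq : ∀ j (hj : j < q.length), m (41 + j) = q[j]
  /-- Then zeros, up to `Q`. -/
  hz : ∀ i, q.length < i → 40 + i < Inline.Qv W → m (40 + i) = 0
  /-- Register `8` holds `2Q`. -/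
  h8 : m 8 = 2 * Inline.Qv W
  /-- All cells are words. -/
  hw : MemLE (2 ^ W - 1) m

/-- A phase that changes only registers (other than `8`) and keeps words preserves the frame. [folklore] -/
theorem Frame.of_agree {W : ℕ} {q : List ℕ} {m m' : ℕ → ℕ} (F : Frame W q m)
    (hagree : ∀ a, 40 ≤ a → m' a = m a) (h8 : m' 8 = m 8) (hw : MemLE (2 ^ W - 1) m') : Frame W q m' where
  h40 := by rw [hagree 40 le_rfl, F.h40]
  hq := fun j hj => by rw [hagree _ (by omega), F.hq j hj]
  hz := fun i hi hiQ => by rw [hagree _ (by omega), F.hz i hi hiQ]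
  h8 := by rw [h8, F.h8]
  hw := hw

/-- Words are `< 2 ^ W`. [folklore] -/
theorem Frame.lt {W : ℕ} {q : List ℕ} {m : ℕ → ℕ} (F : Frame W q m) (a : ℕ) : m a < 2 ^ W := by
  have := F.hw a; have := Nat.one_le_two_pow (n := W); omega

/-- The header is the segment of length `L_h` at cell `41`. [folklore] -/
theorem Frame.readSeg_hdr {W : ℕ} {q : List ℕ} {m : ℕ → ℕ} (F : Frame W q m) (hL : lhOf q ≤ q.length) :
    readSeg m 41 (lhOf q) = hdrOf q := by
  apply List.ext_getElem
  · simp [hdrOf, Nat.min_eq_left hL]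
  · intro j h1 h2
    simp only [readSeg, List.getElem_map, List.getElem_range, hdrOf, List.getElem_take]
    exact F.hq j (by simp at h1; omega)

/-! ## The tails: not well formed, and grow -/

/-- From position `89` the machine clears cell `0` and halts: output `[]`. [folklore] -/
theorem run_from89 {W : ℕ} (c : Cfg) (hpc : c.pc = some 89) :
    run U W noOracle zeroCoins 2 c = some { c with pc := none, mem := Function.update c.mem 0 0 } := by
  obtain ⟨-, -, h89, h90, -⟩ := codeAt_U
  rw [show (2 : ℕ) = 1 + 1 from rfl, run_add, run_one, step_op hpc h89, Option.bind_some, run_one,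
    step_halt rfl h90]
  simp [Operand.write, BinOp.eval]

/-- The output after `run_from89` is empty. [folklore] -/
theorem readOut_update_zero (m : ℕ → ℕ) : readOut (Function.update m 0 0) = [] := by
  simp [readOut, readSeg]

/-- **The grow tail.** From position `334` with the frame intact (and `41 + 3|q| ≤ Q`,
`3|q| + 121 ≤ Q`), the machine halts within `1 + epiCost (3|q|)` steps with output `q ++ 0^(2|q|)`. [folklore] -/
theorem run_grow {W : ℕ} {q : List ℕ} {c : Cfg} (F : Frame W q c.mem) (hpc : c.pc = some 334)
    (hW : 8 ≤ W) (h3L : 3 * q.length + 121 ≤ Inline.Qv W) :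
    ∃ n, n ≤ 1 + Inline.epiCost (3 * q.length) ∧ ∃ c', run U W noOracle zeroCoins n c = some c' ∧
      c'.pc = none ∧ readOut c'.mem = q ++ List.replicate (2 * q.length) 0 := by
  obtain ⟨-, -, -, -, -, -, -, -, -, -, -, -, -, -, -, -, -, -, -, -, -, -, -, -, -, h334, hEPI⟩ := codeAt_U
  have h4Q := Inline.four_mul_Qv (show 2 ≤ W by omega)
  set L := q.length with hL
  have hlt := F.lt
  -- the tripling step
  have h3LW : 3 * L < 2 ^ W := by omega
  have hs : step U W noOracle zeroCoins c =
      some { c with pc := some 335, mem := Function.update c.mem 40 (3 * L) } := by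
    rw [step_op hpc h334]
    simp only [Operand.write, Operand.read_dir, Operand.read_imm, BinOp.eval, F.h40, ← hL]
    rw [Nat.mod_eq_of_lt (by omega), Nat.mul_comm]
  set m1 := Function.update c.mem 40 (3 * L) with hm1
  have hm1w : ∀ a, m1 a < 2 ^ W := fun a => by
    rcases eq_or_ne a 40 with rfl | h
    · rw [hm1, Function.update_self]; omega
    · rw [hm1, Function.update_of_ne h]; exact hlt a
  obtain ⟨n, hn, c', hrun, hpc', -, -, h0, hj⟩ := Inline.run_EPI (P := U) (W := W) (O := noOracle)
    (ρ := zeroCoins) hEPI (c := { c with pc := some 335, mem := m1 }) rfl hm1w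
    (by simp only [hm1]; rw [Function.update_of_ne (by decide), F.h8]) (by simp [hm1]) h3L
  refine ⟨1 + n, by omega, c', ?_, hpc', ?_⟩
  · rw [run_add, run_one, hs, Option.bind_some, hrun]
  · rw [readOut, h0]
    have e2 : 3 * L - L = 2 * L := by omega
    rw [← e2]
    refine readSeg_eq_append_replicate (by omega) (fun j hjL => ?_) (fun j hj1 hj2 => ?_)
    · rw [hj (1 + j) (by omega) (by omega), show 40 + (1 + j) = 41 + j by omega]
      simp only [hm1]; rw [Function.update_of_ne (by omega), F.hq j hjL]
    · rw [hj (1 + j) (by omega) (by omega)]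
      simp only [hm1]; rw [Function.update_of_ne (by omega), F.hz (1 + j) (by omega) (by omega)]

/-! ## The simulation phase -/

/-- The configuration of the stored program after `r` clamped steps on the header. [folklore] -/
def cfgAt (q : List ℕ) (r : ℕ) : Cfg :=
  runTotal (progOf q) (w0Of q) noOracle zeroCoins r (init (w0Of q) (hdrOf q))

/-- `cfgOf` is `cfgAt` at `|q|`. [folklore] -/
theorem cfgOf_eq (q : List ℕ) : cfgOf q = cfgAt q q.length := rfl

/-- One more clamped step. [folklore] -/
theorem cfgAt_succ (q : List ℕ) (r : ℕ) :
    cfgAt q (r + 1) = stepTotal (progOf q) (w0Of q) noOracle zeroCoins (cfgAt q r) :=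
  runTotal_succ' _ _ _ _ _ _

/-- Constants of G6. [folklore] -/
theorem maxConst_G6 : ∀ s ∈ G6, OpSpec.maxConst s ≤ 44 := by decide
/-- Constants of the copy-in body. [folklore] -/
theorem maxConst_cinBody : ∀ s ∈ cinBody, OpSpec.maxConst s ≤ 44 := by decide
/-- Constants of G7. [folklore] -/
theorem maxConst_G7 : ∀ s ∈ G7, OpSpec.maxConst s ≤ 44 := by decide

/-- Iterated straight-line code with constants `≤ 44` keeps words. [folklore] -/
theorem memLE_iterate_of_maxConst {W : ℕ} (hW : 6 ≤ W) {ops : List OpSpec}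
    (hc : ∀ s ∈ ops, OpSpec.maxConst s ≤ 44) :
    ∀ (n : ℕ) {m : ℕ → ℕ}, MemLE (2 ^ W - 1) m → MemLE (2 ^ W - 1) ((fun mm => execOps W mm ops)^[n] m)
  | 0, _, hm => hm
  | n + 1, _, hm => by
      rw [Function.iterate_succ_apply']
      exact memLE_execOps_of_maxConst hW hc (memLE_iterate_of_maxConst hW hc n hm)

/-- The invariant of the main loop with `mm` rounds to go: fuel, constants, the input, and the
representation of `cfgAt q (|q| - mm)` (halting flag, program counter, simulated memory). [folklore] -/
structure SimInv (W : ℕ) (q : List ℕ) (mm : ℕ) (mem : ℕ → ℕ) : Prop where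
  /-- Rounds to go are at most `|q|`. -/
  hle : mm ≤ q.length
  /-- The fuel register. -/
  h10 : mem 10 = mm
  /-- The base register. -/
  h8 : mem 8 = 2 * Inline.Qv W
  /-- The modulus register. -/
  h9 : mem 9 = 2 ^ w0Of q
  /-- The input (and with it the code) is intact. -/
  hq : ∀ j (hj : j < q.length), mem (41 + j) = q[j]
  /-- The halting flag. -/
  h12 : mem 12 = if (cfgAt q (q.length - mm)).pc = none then 1 else 0
  /-- The program counter. -/
  h11 : ∀ p, (cfgAt q (q.length - mm)).pc = some p → mem 11 = p
  /-- The program counter register is small. -/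
  h11le : mem 11 ≤ tOf q - 1
  /-- The simulated memory. -/
  hreg : ∀ a, a ≤ tOf q - 1 → mem (2 * Inline.Qv W + a) = (cfgAt q (q.length - mm)).mem a
  /-- Words. -/
  hw : MemLE (2 ^ W - 1) mem

/-- **One round of the main loop** preserves the invariant (given the geometry of a big,
well-formed input). [folklore] -/
theorem simInv_step {W : ℕ} {q : List ℕ} (hWF : WF q) (hW : 6 ≤ W)
    (hB : 44 + 8 * (tOf q - 1) + 8 ≤ 2 * Inline.Qv W) (hBV : 2 * Inline.Qv W + (tOf q - 1) < 2 ^ W)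
    (hVw : tOf q - 1 + 2 ^ w0Of q < 2 ^ W) (hw₀ : w0Of q ≤ W) (hL41 : 41 + q.length ≤ 2 * Inline.Qv W)
    {mm : ℕ} {mem : ℕ → ℕ} (I : SimInv W q (mm + 1) mem) : SimInv W q mm (execOps W mem STEP) := by
  have hLh := hWF.2
  have hnP : nPOf q ≤ tOf q - 1 := by have := nPOf_lt_tOf hWF; omega
  have h42 : mem 42 = nPOf q := by
    have h1 : 1 < q.length := by unfold lhOf at hLh; omega
    rw [show (42 : ℕ) = 41 + 1 from rfl, I.hq 1 h1]
    unfold nPOf; rw [List.getD_eq_getElem?_getD, List.getElem?_eq_getElem h1]; rfl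
  -- the code hypotheses
  have hcode : ∀ i, i < nPOf q → (progOf q)[i]? = some (Instr.decode (mem (44 + 8 * i)) (mem (44 + 8 * i + 1))
      (mem (44 + 8 * i + 2)) (mem (44 + 8 * i + 3)) (mem (44 + 8 * i + 4)) (mem (44 + 8 * i + 5))
      (mem (44 + 8 * i + 6)) (mem (44 + 8 * i + 7))) := by
    intro i hi
    have hf : ∀ f, f < 8 → mem (44 + 8 * i + f) = (q.drop 3).getD (8 * i + f) 0 := by
      intro f hf
      have hlt : 3 + (8 * i + f) < q.length := by unfold lhOf at hLh; omega
      rw [drop3_getD hlt, show 44 + 8 * i + f = 41 + (3 + (8 * i + f)) by omega, I.hq _ hlt]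
    have hf0 := hf 0 (by omega)
    rw [Nat.add_zero, Nat.add_zero] at hf0
    rw [progOf, Program.getElem?_decode _ hi, ← hf0, ← hf 1 (by omega), ← hf 2 (by omega),
      ← hf 3 (by omega), ← hf 4 (by omega), ← hf 5 (by omega), ← hf 6 (by omega), ← hf 7 (by omega)]
  have hcodeV : ∀ i f, i < nPOf q → f < 8 → mem (44 + 8 * i + f) ≤ tOf q - 1 := by
    intro i f hi hf
    have hlt : 3 + (8 * i + f) < lhOf q := by unfold lhOf; omega
    rw [show 44 + 8 * i + f = 41 + (3 + (8 * i + f)) by omega, I.hq _ (by omega)]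
    have := getElem_lt_tOf hWF hlt
    omega
  obtain ⟨hcm, hpcV⟩ := cfg_bounds hWF (q.length - (mm + 1))
  obtain ⟨r12, r11, r11le, rreg, r10, r8, r9, rhi, rw⟩ := round_spec hW I.hw I.h8 I.h9 h42 hnP
    (by rw [I.h10]; omega) hB hBV hVw hw₀ (progOf_length q) hcode hcodeV I.h12 I.h11 I.h11le I.hreg hcm
  have hsucc : cfgAt q (q.length - mm) = stepTotal (progOf q) (w0Of q) noOracle zeroCoins
      (cfgAt q (q.length - (mm + 1))) := by
    have := I.hle
    rw [show q.length - mm = q.length - (mm + 1) + 1 by omega, cfgAt_succ]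
  exact {
    hle := by have := I.hle; omega
    h10 := by rw [r10, I.h10]; rfl
    h8 := by rw [r8, I.h8]
    h9 := by rw [r9, I.h9]
    hq := fun j hj => by rw [rhi _ (by omega) (Or.inl (by omega)), I.hq j hj]
    h12 := by rw [r12, hsucc]
    h11 := fun p hp => r11 p (by rw [← hsucc]; exact hp)
    h11le := r11le
    hreg := fun a ha => by rw [rreg a ha, hsucc]
    hw := rw }

/-- The answer bit as the product of the halting flag and the output test. [folklore] -/
theorem bitOf_eq (q : List ℕ) :
    bitOf q = (if (cfgOf q).pc = none then 1 else 0) *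
      (if (cfgOf q).mem 0 = 1 ∧ (cfgOf q).mem 1 = 1 then 1 else 0) := by
  simp only [bitOf, readOut_eq_singleton_one_iff]
  by_cases h1 : (cfgOf q).pc = none <;> by_cases h2 : (cfgOf q).mem 0 = 1 ∧ (cfgOf q).mem 1 = 1 <;>
    simp [h1, h2]

/-- **The simulation phase.** From position `164` with the frame intact, zeros from `Q` on, `R3 = L_h`
and `R9 = 2 ^ w₀`, on a big well-formed input the machine copies the header into the simulated
memory, runs `|q|` rounds of the interpreter and halts with output `[1 + bit]`, within
`6 L_h + 149 |q| + 17` steps. [folklore] -/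
theorem run_final {W : ℕ} {q : List ℕ} {c : Cfg} (F : Frame W q c.mem) (hpc : c.pc = some 164)
    (hWF : WF q) (hBig : Big q) (hQ0 : ∀ a, Inline.Qv W ≤ a → c.mem a = 0)
    (h3 : c.mem 3 = lhOf q) (h9 : c.mem 9 = 2 ^ w0Of q) (hW : 8 ≤ W)
    (hgeo : 64 * (2 ^ inputWidth q * 2 ^ inputWidth q) ≤ Inline.Qv W) :
    ∃ n, n ≤ 6 * lhOf q + 149 * q.length + 17 ∧ ∃ c', run U W noOracle zeroCoins n c = some c' ∧
      c'.pc = none ∧ readOut c'.mem = [1 + bitOf q] := by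
  obtain ⟨-, -, -, -, -, -, -, -, -, -, -, -, -, -, -, -, -, -, -, hG6, hcin, hG7, hloop, hG8, h333, -, -⟩ :=
    codeAt_U
  -- geometry
  have h4Q := Inline.four_mul_Qv (show 2 ≤ W by omega)
  set Q := Inline.Qv W with hQdef
  set L := q.length with hLdef
  set X := 2 ^ inputWidth q with hXdef
  have hLX : L < X := length_lt_two_pow_inputWidth q
  have hX2 : 2 ≤ X := by
    have := Nat.pow_le_pow_right (show 0 < 2 by norm_num) (inputWidth_pos q); simpa [hXdef] using this
  have hXX : 2 * X ≤ X * X := Nat.mul_le_mul_right _ hX2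
  have hLh := hWF.2
  have ht := hBig.1
  have ht2 := two_le_tOf q
  have hw0t := two_pow_w0_le_tOf q
  set t := tOf q with htdef
  have h256 : 256 ≤ 2 ^ W := by
    have := Nat.pow_le_pow_right (show 0 < 2 by norm_num) hW; simpa using this
  have h64 : 64 ≤ 2 ^ W := by omega
  obtain ⟨Y, hY⟩ : ∃ Y, Y = X * X := ⟨_, rfl⟩
  rw [← hY] at hXX hgeo
  have hB : 44 + 8 * (t - 1) + 8 ≤ 2 * Q := by omega
  have hBV : 2 * Q + (t - 1) < 2 ^ W := by omega
  have hVw : t - 1 + 2 ^ w0Of q < 2 ^ W := by omega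
  have hw₀ : w0Of q ≤ W := by
    by_contra h
    have : 2 ^ W < 2 ^ w0Of q := Nat.pow_lt_pow_right (by norm_num) (by omega)
    omega
  have hL41 : 41 + L ≤ 2 * Q := by omega
  have hlt := F.lt
  -- G6 (4 steps)
  obtain ⟨a2Q, a19, a20, a21, af⟩ := execOps_G6 (W := W) c.mem (by rw [F.h8]; omega) (by rw [F.h8]; omega)
    (hlt 3) h64
  rw [F.h8] at a2Q a21 af
  have r1 := run_ops (P := U) (w := W) (O := noOracle) (ρ := zeroCoins) G6 hG6 (c := c) hpc
  set m1 := execOps W c.mem G6 with hm1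
  have w1 : MemLE (2 ^ W - 1) m1 := memLE_execOps_of_maxConst (by omega) maxConst_G6 F.hw
  -- the copy-in loop (6 L_h + 1 steps)
  have hcinIt := iterate_cinBody (W := W) (m := m1) (d₀ := 2 * Q + 1) (n := lhOf q) (by omega) (by omega)
    a20 a21 (by rw [a19, h3])
  have r2 := run_loop (P := U) (w := W) (O := noOracle) (ρ := zeroCoins) (i₀ := 168) (RC := 19)
    (body := cinBody) (Inv := fun mm mem => ∃ j, j + mm = lhOf q ∧ mem = (fun m => execOps W m cinBody)^[j] m1)
    (fun mm mem ⟨j, hj, hmem⟩ => by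
      rw [hmem, hcinIt j (by omega)]; simp [cinMem]; omega)
    (fun mm mem ⟨j, hj, hmem⟩ => ⟨j + 1, by omega, by
      rw [hmem]; exact (Function.iterate_succ_apply' (fun m => execOps W m cinBody) j m1).symm⟩)
    hcin (lhOf q) (c := ⟨some 168, m1, c.coinPos, c.queries⟩) rfl ⟨0, by omega, rfl⟩
  simp only [show cinBody.length = 4 from rfl, Nat.reduceAdd] at r2
  set m2 := (fun m => execOps W m cinBody)^[lhOf q] m1 with hm2
  have hm2c : m2 = cinMem m1 (2 * Q + 1) (lhOf q) (lhOf q) := hcinIt _ le_rfl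
  have w2 : MemLE (2 ^ W - 1) m2 := memLE_iterate_of_maxConst (by omega) maxConst_cinBody _ w1
  -- the memory after the copy-in: cells off the simulated segment and registers 19–21
  have m2f : ∀ a, a ≠ 19 → a ≠ 20 → a ≠ 21 → ¬ (2 * Q + 1 ≤ a ∧ a < 2 * Q + 1 + lhOf q) → m2 a = m1 a := by
    intro a h19 h20 h21 hr
    rw [hm2c]; simp only [cinMem]; rw [if_neg h20, if_neg h21, if_neg h19, if_neg hr]
  have m2r : ∀ i (hi : i < lhOf q), m2 (2 * Q + 1 + i) = q[i]'(by omega) % 2 ^ w0Of q := by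
    intro i hi
    rw [hm2c]; simp only [cinMem]
    rw [if_neg (by omega), if_neg (by omega), if_neg (by omega), if_pos ⟨by omega, by omega⟩,
      Nat.add_sub_cancel_left, af _ (by omega) (by omega) (by omega) (by omega), F.hq i (by omega),
      af 9 (by omega) (by omega) (by omega) (by omega), h9]
  -- G7 (3 steps)
  have b40 : m2 40 = L := by
    rw [m2f 40 (by omega) (by omega) (by omega) (by omega), af 40 (by omega) (by omega) (by omega) (by omega), F.h40]
  obtain ⟨g10, g11, g12, gf⟩ := execOps_G7 (W := W) m2 (by rw [b40]; omega)
  have r3 := run_ops (P := U) (w := W) (O := noOracle) (ρ := zeroCoins) G7 hG7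
    (c := ⟨some 174, m2, c.coinPos, c.queries⟩) rfl
  set m3 := execOps W m2 G7 with hm3
  have w3 : MemLE (2 ^ W - 1) m3 := memLE_execOps_of_maxConst (by omega) maxConst_G7 w2
  -- the initial invariant
  have hlenh : (hdrOf q).length = lhOf q := by simp [hdrOf, Nat.min_eq_left hLh]
  have I0 : SimInv W q L m3 := {
    hle := le_rfl
    h10 := by rw [g10, b40]
    h8 := by rw [gf 8 (by decide), m2f 8 (by omega) (by omega) (by omega) (by omega), af 8 (by omega) (by omega)
      (by omega) (by omega), F.h8]
    h9 := by rw [gf 9 (by decide), m2f 9 (by omega) (by omega) (by omega) (by omega), af 9 (by omega) (by omega)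
      (by omega) (by omega), h9]
    hq := fun j hj => by
      rw [gf _ (not_mem_dests_of_le (by decide) (by omega)), m2f _ (by omega) (by omega) (by omega) (by omega),
        af _ (by omega) (by omega) (by omega) (by omega), F.hq j hj]
    h12 := by rw [g12, Nat.sub_self]; simp [cfgAt]
    h11 := fun p hp => by
      rw [g11]; rw [← hLdef, Nat.sub_self] at hp; simpa [cfgAt] using hp
    h11le := by rw [g11]; omega
    hreg := fun a ha => by
      rw [Nat.sub_self, gf _ (not_mem_dests_of_le (by decide) (by omega))]
      show m2 (2 * Q + a) = (runTotal (progOf q) (w0Of q) noOracle zeroCoins 0 (init (w0Of q) (hdrOf q))).mem a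
      rw [runTotal_zero]
      rcases Nat.eq_zero_or_pos a with rfl | hapos
      · rw [Nat.add_zero, m2f _ (by omega) (by omega) (by omega) (by omega), a2Q, h3, h9, init_mem_zero, hlenh]
      · by_cases hah : a ≤ lhOf q
        · obtain ⟨i, rfl⟩ : ∃ i, a = i + 1 := ⟨a - 1, by omega⟩
          rw [show 2 * Q + (i + 1) = 2 * Q + 1 + i by omega, m2r i (by omega),
            init_mem_succ _ _ _ (by rw [hlenh]; omega)]
          simp [hdrOf, List.getElem_take]
        · rw [m2f _ (by omega) (by omega) (by omega) (by omega), af _ (by omega) (by omega) (by omega) (by omega),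
            hQ0 _ (by omega), init_mem_of_length_lt _ _ _ (by rw [hlenh]; omega)]
    hw := w3 }
  -- the main loop (149 L + 1 steps)
  have r4 := run_loop (P := U) (w := W) (O := noOracle) (ρ := zeroCoins) (i₀ := 177) (RC := 10)
    (body := STEP) (Inv := SimInv W q) (fun mm mem I => I.h10)
    (fun mm mem I => simInv_step hWF (by omega) hB hBV hVw hw₀ hL41 I)
    hloop L (c := ⟨some 177, m3, c.coinPos, c.queries⟩) rfl I0
  have I4 : SimInv W q 0 ((fun mem => execOps W mem STEP)^[L] m3) :=
    loop_inv_iterate (w := W) (body := STEP) (Inv := SimInv W q)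
      (fun mm mem I => simInv_step hWF (by omega) hB hBV hVw hw₀ hL41 I) L m3 I0
  rw [STEP_length] at r4
  simp only [show G6.length = 4 from rfl] at r1
  simp only [show G7.length = 3 from rfl] at r3
  set m4 := (fun mem => execOps W mem STEP)^[L] m3 with hm4
  -- G8 (7 steps) and halt
  have hV1 : 1 ≤ t - 1 := by omega
  obtain ⟨k0, k1, kf⟩ := execOps_G8 (W := W) m4 (by rw [I4.h8]; omega) (by rw [I4.h8]; omega)
    (by rw [I4.h12]; split_ifs <;> omega) h64
  have r5 := run_ops (P := U) (w := W) (O := noOracle) (ρ := zeroCoins) G8 hG8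
    (c := ⟨some 326, m4, c.coinPos, c.queries⟩) rfl
  simp only [show G8.length = 7 from rfl] at r5
  set m5 := execOps W m4 G8 with hm5
  have r6 : run U W noOracle zeroCoins 1 ⟨some 333, m5, c.coinPos, c.queries⟩ =
      some ⟨none, m5, c.coinPos, c.queries⟩ := by rw [run_one, step_halt rfl h333]
  -- assemble
  refine ⟨4 + ((lhOf q) * 6 + 1) + 3 + (L * 149 + 1) + 7 + 1, by omega, ⟨none, m5, c.coinPos, c.queries⟩, ?_, rfl, ?_⟩
  · have e : c = ⟨some 164, c.mem, c.coinPos, c.queries⟩ := by cases c; simp_all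
    rw [e] at r1
    rw [e, run_add_of_run _ _ _ _ (run_add_of_run _ _ _ _ (run_add_of_run _ _ _ _ (run_add_of_run _ _ _ _
      (run_add_of_run _ _ _ _ r1 r2) r3) r4) r5) r6]
  · -- the output
    simp only
    rw [readOut, k0]
    simp only [readSeg, List.range_one, List.map_cons, List.map_nil, Nat.add_zero, List.cons.injEq, and_true]
    rw [k1, I4.h12, I4.h8, Nat.sub_zero, show (2 * Q) = 2 * Q + 0 from rfl, I4.hreg 0 (by omega),
      show 2 * Q + 0 + 1 = 2 * Q + 1 from rfl, I4.hreg 1 hV1, bitOf_eq, cfgOf_eq]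
    simp only [Nat.sub_zero]

/-! ## The prologue and the tests -/

/-- `inputWidth` is monotone under taking prefixes. [folklore] -/
theorem inputWidth_take_le (q : List ℕ) (n : ℕ) : inputWidth (q.take n) ≤ inputWidth q := by
  unfold inputWidth
  apply Nat.size_le_size
  refine max_le_iff.2 ⟨le_trans (by simp) (le_max_left _ _), le_trans ?_ (le_max_right _ _)⟩
  rw [foldr_max_eq, foldr_max_eq]
  exact max_le_max le_rfl (lmax_le fun a ha => le_lmax_of_mem (List.mem_of_mem_take ha))

/-- **The prologue on the universal program's input**: within `proCost |q| W` steps position `88`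
is reached with the frame established, zeros from `Q` on, and cells `41, 42, 43` holding
`q₀, q₁, q₂` (read as `0` beyond the input). [folklore] -/
theorem run_PRO_U (q : List ℕ) {W : ℕ} (hW : W = 10 * inputWidth q) :
    ∃ n, n ≤ Inline.proCost q.length W ∧ ∃ m0 : ℕ → ℕ,
      run U W noOracle zeroCoins n (init W q) = some ⟨some 88, m0, 0, []⟩ ∧ Frame W q m0 ∧
      (∀ a, Inline.Qv W ≤ a → m0 a = 0) ∧ m0 41 = q.getD 0 0 ∧ m0 42 = q.getD 1 0 ∧ m0 43 = q.getD 2 0 := by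
  have hgeo := geom q
  rw [← hW] at hgeo
  have hwpos := inputWidth_pos q
  set X := 2 ^ inputWidth q with hX
  have hLX : q.length < X := length_lt_two_pow_inputWidth q
  have hX2 : 2 ≤ X := by
    have := Nat.pow_le_pow_right (show 0 < 2 by norm_num) hwpos; simpa [hX] using this
  have hXX : 2 * X ≤ X * X := Nat.mul_le_mul_right _ hX2
  obtain ⟨Y, hY⟩ : ∃ Y, Y = X * X := ⟨_, rfl⟩
  rw [← hY] at hXX hgeo
  have hQL : q.length + 83 ≤ Inline.Qv W := by omega
  obtain ⟨n, hn, m0, hrun, hM, hZ, -, -, -, -, h8, -, -, hw⟩ := Inline.run_PRO (P := U) (W := W) (k := 1)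
    (O := noOracle) (ρ := zeroCoins) (x := q) codeAt_U.1 (by omega) (by omega) hQL
  rw [Nat.one_mul] at hM
  have hcell : ∀ i, i < Inline.Qv W - 40 → m0 (40 + i) = (init (inputWidth q) q).mem i := hM
  have hget : ∀ j, j + 1 < Inline.Qv W - 40 → m0 (41 + j) = q.getD j 0 := by
    intro j hj
    rw [show 41 + j = 40 + (j + 1) by omega, hcell _ hj, List.getD_eq_getElem?_getD]
    by_cases hjL : j < q.length
    · rw [Inline.init_mem_succ_exact le_rfl hjL, List.getElem?_eq_getElem hjL]; rfl
    · rw [init_mem_of_length_lt _ _ _ (by omega), List.getElem?_eq_none (by omega)]; rfl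
  refine ⟨n, hn, m0, hrun, ?_, hZ, hget 0 (by omega), hget 1 (by omega), hget 2 (by omega)⟩
  exact {
    h40 := by rw [show (40 : ℕ) = 40 + 0 from rfl, hcell 0 (by omega), init_mem_zero_of_inputWidth_le le_rfl]
    hq := fun j hj => by
      rw [show 41 + j = 40 + (j + 1) by omega, hcell _ (by omega), Inline.init_mem_succ_exact le_rfl hj]
    hz := fun i hi hiQ => by rw [hcell i (by omega), init_mem_of_length_lt _ _ _ hi]
    h8 := h8
    hw := fun a => by have := hw a; omega }

/-- Not well formed, first test: from `88` with cell `41 ≠ 0`, output `[]` in `3` steps. [folklore] -/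
theorem run_notWF₁ {W : ℕ} {m : ℕ → ℕ} (h41 : m 41 ≠ 0) (cp : ℕ) (qs : List (List ℕ)) :
    run U W noOracle zeroCoins 3 ⟨some 88, m, cp, qs⟩ = some ⟨none, Function.update m 0 0, cp, qs⟩ := by
  obtain ⟨-, h88, -⟩ := codeAt_U
  rw [show (3 : ℕ) = 1 + 2 from rfl, run_add, run_one, step_jz_ne rfl h88 (by simpa using h41),
    Option.bind_some, run_from89 _ rfl]

/-- First test passed: from `88` with cell `41 = 0`, `G1` is executed and position `94` reached
in `4` steps. [folklore] -/
theorem run_test₁ {W : ℕ} {m : ℕ → ℕ} (h41 : m 41 = 0) (cp : ℕ) (qs : List (List ℕ)) :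
    run U W noOracle zeroCoins 4 ⟨some 88, m, cp, qs⟩ = some ⟨some 94, execOps W m G1, cp, qs⟩ := by
  obtain ⟨-, h88, -, -, hG1, -⟩ := codeAt_U
  rw [show (4 : ℕ) = 1 + G1.length from rfl, run_add, run_one, step_jz_zero rfl h88 (by simpa using h41),
    Option.bind_some, run_ops G1 hG1 rfl]
  rfl

/-- Not well formed, second test: from `94` with `R12 ≠ 0`, output `[]` in `4` steps. [folklore] -/
theorem run_notWF₂ {W : ℕ} {m : ℕ → ℕ} (h12 : m 12 ≠ 0) (cp : ℕ) (qs : List (List ℕ)) :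
    run U W noOracle zeroCoins 4 ⟨some 94, m, cp, qs⟩ = some ⟨none, Function.update m 0 0, cp, qs⟩ := by
  obtain ⟨-, -, -, -, -, h94, h95, -⟩ := codeAt_U
  rw [show (4 : ℕ) = 1 + (1 + 2) from rfl, run_add, run_one, step_jz_ne rfl h94 (by simpa using h12),
    Option.bind_some, run_add, run_one, step_jmp rfl h95, Option.bind_some, run_from89 _ rfl]

/-- Words of `q` read with default `0` are below `2 ^ inputWidth q`. [folklore] -/
theorem getD_lt_two_pow_inputWidth (q : List ℕ) (i : ℕ) : q.getD i 0 < 2 ^ inputWidth q := by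
  rw [List.getD_eq_getElem?_getD]
  by_cases hi : i < q.length
  · rw [List.getElem?_eq_getElem hi, Option.getD_some]
    exact lt_two_pow_inputWidth_of_mem _ _ (List.getElem_mem hi)
  · rw [List.getElem?_eq_none (by omega), Option.getD_none]; exact Nat.two_pow_pos _

/-- Constants of G2. [folklore] -/
theorem maxConst_G2 : ∀ s ∈ G2, OpSpec.maxConst s ≤ 44 := by decide
/-- Constants of G3. [folklore] -/
theorem maxConst_G3 : ∀ s ∈ G3, OpSpec.maxConst s ≤ 44 := by decide
/-- Constants of G4. [folklore] -/
theorem maxConst_G4 : ∀ s ∈ G4, OpSpec.maxConst s ≤ 44 := by decide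
/-- Constants of G5. [folklore] -/
theorem maxConst_G5 : ∀ s ∈ G5, OpSpec.maxConst s ≤ 44 := by decide
/-- Constants of the threshold body. [folklore] -/
theorem maxConst_thrBody : ∀ s ∈ thrBody, OpSpec.maxConst s ≤ 44 := by decide
/-- Constants of G5b. [folklore] -/
theorem maxConst_G5b : ∀ s ∈ G5b, OpSpec.maxConst s ≤ 44 := by decide
/-- Constants of G1. [folklore] -/
theorem maxConst_G1 : ∀ s ∈ G1, OpSpec.maxConst s ≤ 44 := by decide

/-- `2 ^ e mod 2 ^ W = 0` forces `W ≤ e`. [folklore] -/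
theorem le_of_two_pow_mod_eq_zero {e W : ℕ} (h : 2 ^ e % 2 ^ W = 0) : W ≤ e :=
  (Nat.pow_dvd_pow_iff_le_right (by norm_num)).1 (Nat.dvd_of_mod_eq_zero h)

/-- **The middle phase** of a well-formed input: from position `94` (first tests passed, `R3 = L_h`,
`R12 = 0`), the width of the header and the threshold are computed, and either the grow
epilogue (position `334`, the input is not big) or the simulation (position `164`, the input is
big, `R9 = 2 ^ w₀`) is reached, within `widthCost |q| W + 9|q| + 20` steps, the frame and the
zeros above `Q` being preserved. [folklore] -/
theorem run_middle {W : ℕ} {q : List ℕ} {m : ℕ → ℕ} (F : Frame W q m)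
    (hQ0 : ∀ a, Inline.Qv W ≤ a → m a = 0) (hWF : WF q) (h3 : m 3 = lhOf q) (h12 : m 12 = 0)
    (h42 : m 42 = nPOf q) (h43 : m 43 = kOf q) (hW : W = 10 * inputWidth q) (cp : ℕ) (qs : List (List ℕ)) :
    ∃ n, n ≤ widthCost q.length W + 9 * q.length + 20 ∧ ∃ m' : ℕ → ℕ, Frame W q m' ∧
      (∀ a, Inline.Qv W ≤ a → m' a = 0) ∧
      ((run U W noOracle zeroCoins n ⟨some 94, m, cp, qs⟩ = some ⟨some 334, m', cp, qs⟩ ∧ ¬ Big q) ∨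
       (run U W noOracle zeroCoins n ⟨some 94, m, cp, qs⟩ = some ⟨some 164, m', cp, qs⟩ ∧ Big q ∧
        m' 3 = lhOf q ∧ m' 9 = 2 ^ w0Of q)) := by
  obtain ⟨-, -, -, -, -, h94, -, hG2, hwc, hG3, h143, hG4, h147, h148, hG5, hthr, hG5b, h162, h163, -⟩ :=
    codeAt_U
  -- geometry
  have hgeo := geom q
  rw [← hW] at hgeo
  have hwpos := inputWidth_pos q
  have hW10 : 10 ≤ W := by omega
  have h4Q := Inline.four_mul_Qv (show 2 ≤ W by omega)
  set Q := Inline.Qv W with hQdef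
  set L := q.length with hLdef
  set X := 2 ^ inputWidth q with hX
  have hLX : L < X := length_lt_two_pow_inputWidth q
  have hwX : inputWidth q < X := Nat.lt_two_pow_self
  have hX2 : 2 ≤ X := by
    have := Nat.pow_le_pow_right (show 0 < 2 by norm_num) hwpos; simpa [hX] using this
  have hXX : 2 * X ≤ X * X := Nat.mul_le_mul_right _ hX2
  have hkX : kOf q < X := getD_lt_two_pow_inputWidth q 2
  have hnX : nPOf q < X := getD_lt_two_pow_inputWidth q 1
  have hwh : inputWidth (hdrOf q) ≤ inputWidth q := inputWidth_take_le q _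
  have heY : eOf q < X * X :=
    calc eOf q ≤ X * inputWidth (hdrOf q) := Nat.mul_le_mul_right _ (max_le (by omega) (by omega))
      _ < X * X := Nat.mul_lt_mul_of_pos_left (by omega) (by omega)
  obtain ⟨Y, hY⟩ : ∃ Y, Y = X * X := ⟨_, rfl⟩
  rw [← hY] at hXX hgeo heY
  have hLh := hWF.2
  have h6 : 6 ≤ W := by omega
  have hwcmono : widthCost (lhOf q) W ≤ widthCost L W := by unfold widthCost; omega
  -- 94: jz taken (1 step), G2 (2 steps)
  have s94 : run U W noOracle zeroCoins 1 ⟨some 94, m, cp, qs⟩ = some ⟨some 96, m, cp, qs⟩ := by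
    rw [run_one, step_jz_zero rfl h94 (by simpa using h12)]
  obtain ⟨b16, b31, bf⟩ := execOps_G2 (W := W) m (by rw [h3]; omega) (by omega)
  have r2 := run_ops (P := U) (w := W) (O := noOracle) (ρ := zeroCoins) G2 hG2 (c := ⟨some 96, m, cp, qs⟩) rfl
  simp only [show G2.length = 2 from rfl] at r2
  set m1 := execOps W m G2 with hm1
  have F1 : Frame W q m1 := F.of_agree (fun a ha => bf a (not_mem_dests_of_le (by decide) ha)) (bf 8 (by decide))
    (memLE_execOps_of_maxConst h6 maxConst_G2 F.hw)
  have z1 : ∀ a, Q ≤ a → m1 a = 0 := fun a ha => by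
    rw [bf a (not_mem_dests_of_le (by decide) (by omega)), hQ0 a ha]
  -- the width routine on the header
  obtain ⟨n₁, hn₁, m2, rwc, -, c26, cf, cw⟩ := run_widthCode (P := U) (W := W) (O := noOracle) (ρ := zeroCoins)
    (i₀ := 98) (kk := 0) hwc (c := ⟨some 98, m1, cp, qs⟩) rfl F1.lt (L := lhOf q) (p := 41)
    (by show m1 16 = lhOf q; rw [b16, h3]) (by show m1 31 = 41; exact b31) (by omega)
    (by omega) (by rw [Nat.zero_mul]; omega)
  simp only at rwc c26 cf
  rw [F1.readSeg_hdr hLh] at c26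
  have F2 : Frame W q m2 := F1.of_agree (fun a ha => cf a (Or.inr (by omega))) (cf 8 (Or.inl (by omega)))
    (fun a => by have := cw a; omega)
  have z2 : ∀ a, Q ≤ a → m2 a = 0 := fun a ha => by rw [cf a (Or.inr (by omega)), z1 a ha]
  have c43 : m2 43 = kOf q := by rw [cf 43 (Or.inr (by omega)), bf 43 (by decide), h43]
  have c42 : m2 42 = nPOf q := by rw [cf 42 (Or.inr (by omega)), bf 42 (by decide), h42]
  have c3 : m2 3 = lhOf q := by rw [cf 3 (Or.inl (by omega)), bf 3 (by decide), h3]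
  -- G3 (4 steps)
  have heq : max (m2 43) 1 * m2 26 = eOf q := by rw [c43, c26]; rfl
  obtain ⟨d13, d14, df⟩ := execOps_G3 (W := W) m2 (by rw [c43]; omega) (by rw [heq]; omega)
  rw [heq] at d13 d14
  have r3 := run_ops (P := U) (w := W) (O := noOracle) (ρ := zeroCoins) G3 hG3 (c := ⟨some 139, m2, cp, qs⟩) rfl
  simp only [show G3.length = 4 from rfl] at r3
  set m3 := execOps W m2 G3 with hm3
  have F3 : Frame W q m3 := F2.of_agree (fun a ha => df a (not_mem_dests_of_le (by decide) ha)) (df 8 (by decide))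
    (memLE_execOps_of_maxConst h6 maxConst_G3 F2.hw)
  have z3 : ∀ a, Q ≤ a → m3 a = 0 := fun a ha => by
    rw [df a (not_mem_dests_of_le (by decide) (by omega)), z2 a ha]
  -- the run so far
  have run139 : run U W noOracle zeroCoins (1 + 2 + n₁ + 4) ⟨some 94, m, cp, qs⟩ = some ⟨some 143, m3, cp, qs⟩ := by
    rw [run_add_of_run _ _ _ _ (run_add_of_run _ _ _ _ (run_add_of_run _ _ _ _ s94 r2) rwc) r3]
  -- 143: is `2 ^ e` a word?
  by_cases hbigW : 2 ^ eOf q % 2 ^ W = 0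
  · -- no: grow
    have hWe : W ≤ eOf q := le_of_two_pow_mod_eq_zero hbigW
    have hnb : ¬ Big q := fun hb => by
      have h1 := hb.1
      have : 2 ^ W ≤ tOf q := Nat.pow_le_pow_right (by norm_num) hWe
      omega
    refine ⟨1 + 2 + n₁ + 4 + 1, by omega, m3, F3, z3, Or.inl ⟨?_, hnb⟩⟩
    exact run_add_of_run _ _ _ _ run139 (by rw [run_one, step_jz_zero rfl h143 (by simpa [d14] using hbigW)]; rfl)
  -- yes: `e < W`, `R14 = 2 ^ e`
  have heW : eOf q < W := by
    by_contra h
    obtain ⟨d, hd⟩ : 2 ^ W ∣ 2 ^ eOf q := Nat.pow_dvd_pow 2 (by omega)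
    exact hbigW (by rw [hd, Nat.mul_mod_right])
  have htW : tOf q < 2 ^ W := Nat.pow_lt_pow_right (by norm_num) heW
  have d14' : m3 14 = tOf q := by rw [d14, Nat.mod_eq_of_lt (show 2 ^ eOf q < 2 ^ W from htW)]; rfl
  have s143 : run U W noOracle zeroCoins 1 ⟨some 143, m3, cp, qs⟩ = some ⟨some 144, m3, cp, qs⟩ := by
    rw [run_one, step_jz_ne rfl h143 (by simpa [d14] using hbigW)]
  -- G4 (3 steps)
  have e26 : m3 26 = inputWidth (hdrOf q) := by rw [df 26 (by decide), c26]
  have e43 : m3 43 = kOf q := by rw [df 43 (by decide), c43]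
  have hkw : m3 43 * m3 26 < W := by
    rw [e43, e26]; exact lt_of_le_of_lt (w0Of_le_eOf q) heW
  obtain ⟨f9, f12, ff⟩ := execOps_G4 (W := W) m3 hkw (by omega)
  rw [e43, e26] at f9
  have e40 : m3 40 = L := F3.h40
  rw [e40, d14'] at f12
  have r4 := run_ops (P := U) (w := W) (O := noOracle) (ρ := zeroCoins) G4 hG4 (c := ⟨some 144, m3, cp, qs⟩) rfl
  simp only [show G4.length = 3 from rfl] at r4
  set m4 := execOps W m3 G4 with hm4
  have F4 : Frame W q m4 := F3.of_agree (fun a ha => ff a (not_mem_dests_of_le (by decide) ha)) (ff 8 (by decide))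
    (memLE_execOps_of_maxConst h6 maxConst_G4 F3.hw)
  have z4 : ∀ a, Q ≤ a → m4 a = 0 := fun a ha => by
    rw [ff a (not_mem_dests_of_le (by decide) (by omega)), z3 a ha]
  have run147 : run U W noOracle zeroCoins (1 + 2 + n₁ + 4 + 1 + 3) ⟨some 94, m, cp, qs⟩ =
      some ⟨some 147, m4, cp, qs⟩ := by
    rw [run_add_of_run _ _ _ _ (run_add_of_run _ _ _ _ run139 s143) r4]
  -- 147: is `2 ^ e ≤ L`?
  by_cases htL : L < tOf q
  · -- no: grow
    have hnb : ¬ Big q := fun hb => by have := hb.1; omega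
    refine ⟨1 + 2 + n₁ + 4 + 1 + 3 + (1 + 1), by omega, m4, F4, z4, Or.inl ⟨?_, hnb⟩⟩
    exact run_add_of_run _ _ _ _ run147 (by
      rw [run_add, run_one, step_jz_ne rfl h147 (by simp [f12, htL]), Option.bind_some, run_one,
        step_jmp rfl h148]; rfl)
  have htL' : tOf q ≤ L := not_lt.1 htL
  have s147 : run U W noOracle zeroCoins 1 ⟨some 147, m4, cp, qs⟩ = some ⟨some 149, m4, cp, qs⟩ := by
    rw [run_one, step_jz_zero rfl h147 (by simp [f12, htL])]
  -- G5 (3 steps)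
  have g42 : m4 42 = nPOf q := by rw [ff 42 (by decide), df 42 (by decide), c42]
  have g40 : m4 40 = L := F4.h40
  have g14 : m4 14 = tOf q := by rw [ff 14 (by decide), d14']
  obtain ⟨i17, i18, i19, iff⟩ := execOps_G5 (W := W) m4 (by rw [g42]; omega) (by rw [g40]; omega)
    (by rw [g14]; exact htW)
  rw [g42] at i17; rw [g40] at i18; rw [g14] at i19
  have r5 := run_ops (P := U) (w := W) (O := noOracle) (ρ := zeroCoins) G5 hG5 (c := ⟨some 149, m4, cp, qs⟩) rfl
  simp only [show G5.length = 3 from rfl] at r5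
  set m5 := execOps W m4 G5 with hm5
  have F5 : Frame W q m5 := F4.of_agree (fun a ha => iff a (not_mem_dests_of_le (by decide) ha)) (iff 8 (by decide))
    (memLE_execOps_of_maxConst h6 maxConst_G5 F4.hw)
  have z5 : ∀ a, Q ≤ a → m5 a = 0 := fun a ha => by
    rw [iff a (not_mem_dests_of_le (by decide) (by omega)), z4 a ha]
  -- the threshold loop (9 t + 1 steps)
  have hov : (L + 1) * tOf q < 2 ^ W :=
    lt_of_le_of_lt (Nat.mul_le_mul (by omega : L + 1 ≤ X) (by omega : tOf q ≤ X)) (by omega)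
  have hthrIt := iterate_thrBody (W := W) (m := m5) (n := nPOf q) (L := L) (t := tOf q) (by have := two_le_tOf q; omega)
    (by rw [iff 14 (by decide), g14]) i18 i17 i19 (by unfold lhOf at hLh; omega) hov (by omega) htW
  have r6 := run_loop (P := U) (w := W) (O := noOracle) (ρ := zeroCoins) (i₀ := 152) (RC := 19)
    (body := thrBody) (Inv := fun mm mem => ∃ j, j + mm = tOf q ∧ mem = (fun m => execOps W m thrBody)^[j] m5)
    (fun mm mem ⟨j, hj, hmem⟩ => by rw [hmem, (hthrIt j (by omega)).2.1]; omega)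
    (fun mm mem ⟨j, hj, hmem⟩ => ⟨j + 1, by omega, by
      rw [hmem]; exact (Function.iterate_succ_apply' (fun m => execOps W m thrBody) j m5).symm⟩)
    hthr (tOf q) (c := ⟨some 152, m5, cp, qs⟩) rfl ⟨0, by omega, rfl⟩
  simp only [show thrBody.length = 7 from rfl, Nat.reduceAdd] at r6
  obtain ⟨j17, -, -, -, jf⟩ := hthrIt (tOf q) le_rfl
  set m6 := (fun m => execOps W m thrBody)^[tOf q] m5 with hm6
  have F6 : Frame W q m6 := F5.of_agree (fun a ha => jf a (not_mem_dests_of_le (by decide) ha)) (jf 8 (by decide))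
    (memLE_iterate_of_maxConst h6 maxConst_thrBody _ F5.hw)
  have z6 : ∀ a, Q ≤ a → m6 a = 0 := fun a ha => by
    rw [jf a (not_mem_dests_of_le (by decide) (by omega)), z5 a ha]
  -- G5b (1 step)
  obtain ⟨k12, kf⟩ := execOps_G5b (W := W) m6
  rw [F6.h40, j17] at k12
  have r7 := run_ops (P := U) (w := W) (O := noOracle) (ρ := zeroCoins) G5b hG5b (c := ⟨some 161, m6, cp, qs⟩) rfl
  simp only [show G5b.length = 1 from rfl] at r7
  set m7 := execOps W m6 G5b with hm7
  have F7 : Frame W q m7 := F6.of_agree (fun a ha => kf a (by omega)) (kf 8 (by omega))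
    (memLE_execOps_of_maxConst h6 maxConst_G5b F6.hw)
  have z7 : ∀ a, Q ≤ a → m7 a = 0 := fun a ha => by rw [kf a (by omega), z6 a ha]
  have run162 : run U W noOracle zeroCoins (1 + 2 + n₁ + 4 + 1 + 3 + 1 + 3 + (tOf q * 9 + 1) + 1)
      ⟨some 94, m, cp, qs⟩ = some ⟨some 162, m7, cp, qs⟩ := by
    rw [run_add_of_run _ _ _ _ (run_add_of_run _ _ _ _ (run_add_of_run _ _ _ _ (run_add_of_run _ _ _ _
      run147 s147) r5) r6) r7]
  -- 162: is the threshold reached?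
  by_cases hthr' : L < min ((nPOf q + 1) * tOf q ^ tOf q) (L + 1)
  · -- no: grow
    have hnb : ¬ Big q := fun hb => by
      have := hb.2
      have : min ((nPOf q + 1) * tOf q ^ tOf q) (L + 1) ≤ L := le_trans (Nat.min_le_left _ _) this
      omega
    refine ⟨1 + 2 + n₁ + 4 + 1 + 3 + 1 + 3 + (tOf q * 9 + 1) + 1 + (1 + 1), by omega, m7, F7, z7, Or.inl ⟨?_, hnb⟩⟩
    exact run_add_of_run _ _ _ _ run162 (by
      rw [run_add, run_one, step_jz_ne rfl h162 (by simp only [Operand.read_dir]; rw [k12, if_pos hthr']; exact one_ne_zero),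
        Option.bind_some, run_one, step_jmp rfl h163]; rfl)
  · -- yes: simulate
    have hb : Big q := by
      refine ⟨htL', ?_⟩
      by_contra hx
      have : min ((nPOf q + 1) * tOf q ^ tOf q) (L + 1) = L + 1 := Nat.min_eq_right (by omega)
      omega
    refine ⟨1 + 2 + n₁ + 4 + 1 + 3 + 1 + 3 + (tOf q * 9 + 1) + 1 + 1, by omega, m7, F7, z7, Or.inr ⟨?_, hb, ?_, ?_⟩⟩
    · exact run_add_of_run _ _ _ _ run162 (by
        rw [run_one, step_jz_zero rfl h162 (by simp only [Operand.read_dir]; rw [k12, if_neg hthr'])])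
    · rw [kf 3 (by omega), jf 3 (by decide), iff 3 (by decide), ff 3 (by decide), df 3 (by decide), c3]
    · rw [kf 9 (by omega), jf 9 (by decide), iff 9 (by decide), f9]; rfl

/-! ## The universal program: complete specification -/

/-- The time bound of the universal program on an input of length `L` at word size `W`. [folklore] -/
def uCost (L W : ℕ) : ℕ := Inline.proCost L W + widthCost L W + 182 * L + 400

/-- **Specification of the universal program.** On every input `q`, at word size
`10 · inputWidth q`, the universal program halts within `uCost |q| W` steps with output
`uAnswer q`. [folklore] -/
theorem run_U (q : List ℕ) :
    ∃ n, n ≤ uCost q.length (10 * inputWidth q) ∧ ∃ c, run U (10 * inputWidth q) noOracle zeroCoins n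
      (init (10 * inputWidth q) q) = some c ∧ c.pc = none ∧ readOut c.mem = uAnswer q := by
  set W := 10 * inputWidth q with hW
  -- geometry
  have hgeo := geom q
  rw [← hW] at hgeo
  have hwpos := inputWidth_pos q
  have hW10 : 10 ≤ W := by omega
  have h4Q := Inline.four_mul_Qv (show 2 ≤ W by omega)
  set Q := Inline.Qv W with hQdef
  set X := 2 ^ inputWidth q with hX
  have hLX : q.length < X := length_lt_two_pow_inputWidth q
  have hX2 : 2 ≤ X := by
    have := Nat.pow_le_pow_right (show 0 < 2 by norm_num) hwpos; simpa [hX] using this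
  have hXX : 2 * X ≤ X * X := Nat.mul_le_mul_right _ hX2
  have hnX : nPOf q < X := getD_lt_two_pow_inputWidth q 1
  obtain ⟨Y, hY⟩ : ∃ Y, Y = X * X := ⟨_, rfl⟩
  rw [← hY] at hXX hgeo
  have h6 : 6 ≤ W := by omega
  -- the prologue
  obtain ⟨n₀, hn₀, m0, r0, F0, z0, h41, h42, h43⟩ := run_PRO_U q hW
  by_cases hq0 : q.getD 0 0 = 0
  swap
  · -- not well formed: the first word is not `0`
    have hnWF : ¬ WF q := fun h => hq0 h.1
    refine ⟨n₀ + 3, by unfold uCost; omega, _, run_add_of_run _ _ _ _ r0 (run_notWF₁ (m := m0) (by rw [h41]; exact hq0) 0 []),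
      rfl, ?_⟩
    rw [readOut_update_zero, uAnswer, if_neg hnWF]
  -- first test passed
  have r1 := run_test₁ (W := W) (m := m0) (by rw [h41, hq0]) 0 []
  have h42' : m0 42 = nPOf q := h42
  obtain ⟨a3, a12, af⟩ := execOps_G1 (W := W) m0 (by rw [h42']; omega)
  rw [h42'] at a3 a12; rw [F0.h40] at a12
  set m1 := execOps W m0 G1 with hm1
  have hlh : 8 * nPOf q + 3 = lhOf q := by unfold lhOf; omega
  rw [hlh] at a3 a12
  by_cases hL : lhOf q ≤ q.length
  swap
  · -- not well formed: shorter than the announced header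
    have hnWF : ¬ WF q := fun h => hL h.2
    refine ⟨n₀ + (4 + 4), by unfold uCost; omega, _,
      run_add_of_run _ _ _ _ r0 (run_add_of_run _ _ _ _ r1 (run_notWF₂ (m := m1) (by rw [a12, if_pos (by omega)]; exact one_ne_zero) 0 [])),
      rfl, ?_⟩
    rw [readOut_update_zero, uAnswer, if_neg hnWF]
  -- well formed
  have hWF : WF q := ⟨hq0, hL⟩
  have F1 : Frame W q m1 := F0.of_agree (fun a ha => af a (not_mem_dests_of_le (by decide) ha)) (af 8 (by decide))
    (memLE_execOps_of_maxConst h6 maxConst_G1 F0.hw)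
  have z1 : ∀ a, Q ≤ a → m1 a = 0 := fun a ha => by
    rw [af a (not_mem_dests_of_le (by decide) (by omega)), z0 a ha]
  obtain ⟨n₂, hn₂, m', F', z', hmid⟩ := run_middle F1 z1 hWF a3 (by rw [a12, if_neg (by omega)])
    (by rw [af 42 (by decide), h42]; rfl) (by rw [af 43 (by decide), h43]; rfl) hW 0 []
  rcases hmid with ⟨rmid, hnb⟩ | ⟨rmid, hb, h3', h9'⟩
  · -- grow
    obtain ⟨n₃, hn₃, c', r3, hpc', hout⟩ := run_grow (c := ⟨some 334, m', 0, []⟩) F' rfl (by omega) (by omega)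
    refine ⟨n₀ + (4 + (n₂ + n₃)), ?_, c', run_add_of_run _ _ _ _ r0 (run_add_of_run _ _ _ _ r1
      (run_add_of_run _ _ _ _ rmid r3)), hpc', ?_⟩
    · unfold uCost; unfold Inline.epiCost at hn₃; omega
    · rw [hout, uAnswer, if_pos hWF, if_neg hnb]
  · -- simulate
    obtain ⟨n₃, hn₃, c', r3, hpc', hout⟩ := run_final (c := ⟨some 164, m', 0, []⟩) F' rfl hWF hb z' h3' h9'
      (by omega) (by rw [hY, hX] at hgeo; exact hgeo)
    refine ⟨n₀ + (4 + (n₂ + n₃)), ?_, c', run_add_of_run _ _ _ _ r0 (run_add_of_run _ _ _ _ r1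
      (run_add_of_run _ _ _ _ rmid r3)), hpc', ?_⟩
    · unfold uCost; omega
    · rw [hout, uAnswer, if_pos hWF, if_pos hb]

/-- **The universal program as an algorithm**: `OutputsWithin` form of `run_U`. [folklore] -/
theorem outputsWithin_U (q : List ℕ) :
    OutputsWithin U (10 * inputWidth q) noOracle zeroCoins q (uAnswer q) (uCost q.length (10 * inputWidth q)) := by
  obtain ⟨n, hn, c, hrun, hpc, hout⟩ := run_U q
  rw [← hout]
  exact outputsWithin_of_run hrun ((step_eq_none_iff _ _ _ _ _).2 hpc) hn

end Univ

end Literature.Computability.Cryptography.WordRAM
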